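import Literature.Analysis.FluidPDE.HolderHalfDirectionStretching
import Literature.Analysis.FluidPDE.LocalBiotSavartHelmholtz
import HarnessLib

/-!
# The localized stretching estimate under local ½-Hölder coherence of the vorticity direction
# (Grujić 2009, Thm. 1: the estimate of `T₃` on one parabolic cylinder)

Analysis/FluidPDE proof file (theorems only: no definition, no named fact, no `sorry`), second brick
of the discharge of `Literature.Analysis.FluidPDE.grujic2009_localized_halfHolder_coherence`
(`GrujicLocalizedCoherence.lean`; Z. Grujić, *Localization and geometric depletion of
vortex-stretching in the 3D NSE*, Comm. Math. Phys. **290** (2009) 861–870, Thm. 1, proof §§3–5).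

Grujić bounds the localized vortex-stretching term `T₃ = ∫∫ (ω·∇)u · ψ²ω` (p. 865) by splitting
"the contribution of the region of the low vorticity magnitude from the contribution of the region
of the high vorticity magnitude, `T₃ ≤ T₃ˡ + T₃ʰ`" (p. 866), using for `T₃ʰ` the localization
formula (4) and the geometric depletion of its kernel by the ½-Hölder coherence,
"`T₃ʰ ≤ c ∫∫ |x−y|^{-5/2} ψ(y)|ω|(y) ψ(x)|ω|²(x) dy dx dt + the lower order terms`" ((8), p. 867),
then "Hölder (in `x`) with the exponents 4, 4 and 2, and then the weak Young … followed by
interpolating the first two `Lᵖ`-norms" (p. 867).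

This file proves the corresponding **fixed-time** estimate in the frame of the tree's
Constantin–Fefferman / Beirão da Veiga–Berselli bricks (`ConstantinFeffermanStretching.lean`,
`HolderHalfDirectionStretching.lean`), of which it is the localized twin:

* `exists_abs_inner_highPart_fderiv_biotSavart_cutoff_le_holder` — the depleted pointwise majorant
  for the self-stretching of the high vorticity cut off to a ball (`f = χ ω_hi`),
  `|⟪ω_hi(x), ∇(K∗f)(x) ω_hi(x)⟫| ≤ A M |ω(x)|² ∫|x−y|^{-5/2}|f(y)| dy`, when the direction hypothesis
  `√(1 − ⟪ξ(x),ξ(y)⟫²) ≤ M|x−y|^{1/2}` holds for `x, y` in a set containing the support of `χ`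
  (`exists_abs_inner_fderiv_biotSavart_le`, `VorticityDirectionDepletion.lean`);
* `localized_stretching_count` — the final arithmetic (Young twice);
* `exists_abs_inner_highPart_fderiv_biotSavart_cutoff_le_holderExp` — the same depleted majorant
  for a general Hölder exponent `α > 0` (kernel `|x−y|^{α−3}`; Grujić–Zhang 2006 §3), first brick
  of a localized twin of the hybrid criteria;
* `exists_localized_stretching_le_of_holderHalf` — **the localized stretching estimate**: fix a
  centre `c`, a radius `s > 0`, a weight `φ ∈ C¹`, `0 ≤ φ ≤ 1`, `tsupport φ ⊆ B̄(c, s)`, and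
  `ν, Ω > 0`, `M`. There are `C₁, …, C₄ ≥ 0` such that for every `V ∈ C²(ℝ³; ℝ³)` which is
  divergence free on `B(c, 6s)` and whose vorticity direction satisfies the ½-Hölder hypothesis for
  all pairs of points of `B(c, 6s)` where `|curl V| > Ω`,
  `2∫φ²⟪ω,(∇V)ω⟫ ≤ ν∫φ²|∇ω|²_F + (C₁ + C₂(Y + F) + C₃E)∫φ²|ω|² + C₄(Y + F)`,
  `ω = curl V`, with the LOCAL sizes `Y = ∫_{B̄(c,6s)}|ω|²`, `F = ∫_{B̄(c,6s)}‖∇V‖²`,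
  `E = ∫_{B̄(c,6s)}|V|²`.

## The argument (deviations from print recorded)

Split `ω = ω_lo + ω_hi` smoothly at `R = 2Ω` (`VorticityHighPart.lean`), put `f = χω_hi` with the
ball cutoff `χ = ballCutoff c (2s)` and `U = V − K∗f`. Pointwise
`⟪ω,∇Vω⟫ = [⟪ω_lo,∇Vω⟫ + ⟪ω_hi,∇Vω_lo⟫] + ⟪ω_hi,∇Uω_hi⟫ + ⟪ω_hi,∇(K∗f)ω_hi⟫`, multiplied by `φ²`:
* the bracket is `≤ 2R(‖∇V‖² + |ω|²)` (`abs_inner_low_terms_le`) — Grujić's `T₃ˡ ≤ c∫|∇u|²`;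
* `∫φ²⟪ω_hi,∇Uω_hi⟫ = ∫⟪Z,∇U Z⟫`, `Z = φω_hi`, is integrated by parts
  (`abs_integral_inner_fderiv_apply_le_of_hasCompactSupport`, applied to `θU` with `θ = ballCutoff c s`)
  with the LOCAL sup bound `‖U‖ ≤ 120Ωs + C∫_{B̄(c,6s)}(|ω| + ‖∇V‖ + |V|)` on `B(c,3s)`
  (`exists_norm_sub_biotSavart_ballCutoff_le`, `LocalBiotSavartHelmholtz.lean`) — this replaces
  Grujić's lower-order terms `I_LOT` (pp. 868–869);
* `∫φ²⟪ω_hi,∇(K∗f)ω_hi⟫` by the depleted majorant, the two-radii inequality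
  `lintegral_mul_rieszHalfPotential_le_two_radii` at `δ = (1 + √Y)⁻¹`, Cauchy–Schwarz
  `∫φ⁴|ω|⁴ ≤ ‖φω‖₂‖φω‖₆³` and Sobolev on `φω` (`eLpNorm_six_le_eLpNorm_fderiv_two`) — the tree's
  Lorentz/HLS-free form of the printed "Hölder 4,4,2 + weak Young + interpolation".
Young's inequality absorbs `‖φ∇ω‖₂` into `ν∫φ²|∇ω|²_F`; the `∇φ` commutators are harmless because
they only see `|ω|` on `B̄(c,s)`. Constants depend on `c, s, φ, ν, Ω, M` (non-sharp).

## References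

* Z. Grujić, Comm. Math. Phys. 290 (2009) 861–870, Thm. 1 and its proof, §5 pp. 866–869
  (`T₃ ≤ T₃ˡ + T₃ʰ`, (8), the Hölder/Young/interpolation chain). [Grujic2009]
* H. Beirão da Veiga, L. C. Berselli, Differential Integral Equations 15 (2002) 345–356, Lemma 4.1
  (4.6)–(4.12) (the whole-space `½`-Hölder estimate). [BeiraodaveigaBerselli2002]
* P. Constantin, C. Fefferman, Indiana Univ. Math. J. 42 (1993), §2. [ConstantinFeffermanIndiana1993]
-/

noncomputable section

open MeasureTheory Set Function Filter Metric Real InnerProductSpace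
open _root_.Topology
open scoped ENNReal NNReal RealInnerProductSpace

namespace Literature.Analysis.FluidPDE

-- nested operator types `ℝ³ →L[ℝ] ℝ³ →L[ℝ] ℝ³` (second derivatives)
set_option maxSynthPendingDepth 3

/-! ### Private helpers -/

/-- `√r · (r³)⁻¹ = r^{-5/2}` for `r > 0`. [folklore] -/
private theorem sqrt_mul_inv_cube' {r : ℝ} (hr : 0 < r) :
    Real.sqrt r * (r ^ 3)⁻¹ = r ^ (-(5 / 2 : ℝ)) := by
  rw [Real.sqrt_eq_rpow, ← Real.rpow_natCast, ← Real.rpow_neg hr.le, ← Real.rpow_add hr]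
  norm_num

/-- The potential `∫ |x−y|^{-5/2} |h(y)| dy` of a continuous compactly supported `h` converges
absolutely. [folklore] -/
private theorem integrable_rieszHalfKernel_mul_norm'
    {h : (EuclideanSpace ℝ (Fin 3)) → (EuclideanSpace ℝ (Fin 3))} (hh : Continuous h)
    (hhc : HasCompactSupport h) (x : (EuclideanSpace ℝ (Fin 3))) :
    Integrable fun y => ‖x - y‖ ^ (-(5 / 2 : ℝ)) * ‖h y‖ := by
  obtain ⟨M₀, hM₀⟩ := hh.bounded_above_of_compact_support hhc
  have hM₀0 : 0 ≤ M₀ := (norm_nonneg _).trans (hM₀ x)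
  obtain ⟨R₀, hR₀⟩ := hhc.isCompact.isBounded.subset_closedBall (0 : (EuclideanSpace ℝ (Fin 3)))
  set ρ' : ℝ := |R₀| + ‖x‖ + 1 with hρ'
  have hball : Integrable fun z : (EuclideanSpace ℝ (Fin 3)) =>
      (ball (0 : (EuclideanSpace ℝ (Fin 3))) ρ').indicator (fun z => ‖z‖ ^ (-(5 / 2 : ℝ))) z := by
    rw [integrable_indicator_iff measurableSet_ball]
    exact NewtonPotentialHolder.integrableOn_ball_norm_rpow_neg (by norm_num) ρ'
  have hmaj : Integrable fun y => M₀ *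
      (ball (0 : (EuclideanSpace ℝ (Fin 3))) ρ').indicator (fun z => ‖z‖ ^ (-(5 / 2 : ℝ))) (x - y) :=
    (hball.comp_sub_left x).const_mul _
  have hmeas : AEStronglyMeasurable (fun y => ‖x - y‖ ^ (-(5 / 2 : ℝ)) * ‖h y‖) volume :=
    (((measurable_const.sub measurable_id).norm.pow_const _).mul
      hh.measurable.norm).aestronglyMeasurable
  refine hmaj.mono' hmeas (Eventually.of_forall fun y => ?_)
  have hk0 : 0 ≤ ‖x - y‖ ^ (-(5 / 2 : ℝ)) := Real.rpow_nonneg (norm_nonneg _) _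
  rw [Real.norm_of_nonneg (mul_nonneg hk0 (norm_nonneg _))]
  by_cases hy : h y = 0
  · rw [hy, norm_zero, mul_zero]
    exact mul_nonneg hM₀0 (indicator_nonneg (fun z _ => Real.rpow_nonneg (norm_nonneg _) _) _)
  · have hyR : ‖y‖ ≤ R₀ := mem_closedBall_zero_iff.1 (hR₀ (subset_tsupport _ (mem_support.2 hy)))
    have hxy : ‖x - y‖ < ρ' := by
      calc ‖x - y‖ ≤ ‖x‖ + ‖y‖ := norm_sub_le _ _
        _ < |R₀| + ‖x‖ + 1 := by linarith [le_abs_self R₀]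
    have hmem : x - y ∈ ball (0 : (EuclideanSpace ℝ (Fin 3))) ρ' := mem_ball_zero_iff.2 hxy
    rw [indicator_of_mem hmem]
    calc ‖x - y‖ ^ (-(5 / 2 : ℝ)) * ‖h y‖ ≤ ‖x - y‖ ^ (-(5 / 2 : ℝ)) * M₀ :=
          mul_le_mul_of_nonneg_left (hM₀ y) hk0
      _ = M₀ * ‖x - y‖ ^ (-(5 / 2 : ℝ)) := mul_comm _ _

/-- Young's inequality with exponents `(4, 4/3)` in polynomial form:
`2 a t³ ≤ ε t⁴ + 27 a⁴/(16 ε³)` for `a, t ≥ 0`, `ε > 0`. [folklore] -/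
private theorem two_mul_mul_cube_le' {ε a t : ℝ} (hε : 0 < ε) (ha : 0 ≤ a) (ht : 0 ≤ t) :
    2 * a * t ^ 3 ≤ ε * t ^ 4 + 27 * a ^ 4 / (16 * ε ^ 3) := by
  set u : ℝ := a / (2 * ε) with hu
  have hu0 : 0 ≤ u := by positivity
  have hpoly : 4 * u * t ^ 3 ≤ t ^ 4 + 27 * u ^ 4 := by
    have h : 0 ≤ (t - 3 * u) ^ 2 * (t ^ 2 + 2 * u * t + 3 * u ^ 2) := by positivity
    have hexp : (t - 3 * u) ^ 2 * (t ^ 2 + 2 * u * t + 3 * u ^ 2) =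
        t ^ 4 + 27 * u ^ 4 - 4 * u * t ^ 3 := by ring
    rw [hexp] at h
    linarith
  have ha' : a = 2 * ε * u := by rw [hu]; field_simp
  have h1 : 2 * a * t ^ 3 = ε * (4 * u * t ^ 3) := by rw [ha']; ring
  have h2 : 27 * a ^ 4 / (16 * ε ^ 3) = ε * (27 * u ^ 4) := by
    rw [ha']; field_simp; ring
  rw [h1, h2, ← mul_add]
  exact mul_le_mul_of_nonneg_left hpoly hε.le

/-- A function whose topological support lies in a closed ball has compact support. [folklore] -/
private theorem weight_hasCompactSupport_of_tsupport_subset {φ : (EuclideanSpace ℝ (Fin 3)) → ℝ}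
    {c : (EuclideanSpace ℝ (Fin 3))} {s : ℝ} (h : tsupport φ ⊆ closedBall c s) : HasCompactSupport φ :=
  IsCompact.of_isClosed_subset (isCompact_closedBall c s) (isClosed_tsupport φ) h

/-- `φ² g` is integrable for continuous `φ, g` with `φ` compactly supported. [folklore] -/
private theorem integrable_sq_mul_of_hasCompactSupport {φ : (EuclideanSpace ℝ (Fin 3)) → ℝ}
    (hφ : Continuous φ) (hφc : HasCompactSupport φ) {g : (EuclideanSpace ℝ (Fin 3)) → ℝ}
    (hg : Continuous g) : Integrable fun x => φ x ^ 2 * g x := by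
  have hc : HasCompactSupport (fun x => φ x ^ 2 * g x) := by
    refine hφc.mono fun x hx => ?_
    rw [mem_support] at hx ⊢
    intro h
    exact hx (by rw [h]; ring)
  exact ((hφ.pow 2).mul hg).integrable_of_hasCompactSupport hc

/-- `∫ φ² g ≤ ∫_{B̄(c,r)} g` for `0 ≤ φ ≤ 1` supported in `B̄(c,r)` and `g ≥ 0`. [folklore] -/
private theorem integral_sq_mul_le_setIntegral {φ : (EuclideanSpace ℝ (Fin 3)) → ℝ}
    (hφ : Continuous φ) (hφ01 : ∀ x, 0 ≤ φ x ∧ φ x ≤ 1) {c : (EuclideanSpace ℝ (Fin 3))} {r : ℝ}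
    (hφs : tsupport φ ⊆ closedBall c r) {g : (EuclideanSpace ℝ (Fin 3)) → ℝ} (hg : Continuous g)
    (hg0 : ∀ x, 0 ≤ g x) :
    ∫ x, φ x ^ 2 * g x ≤ ∫ x in closedBall c r, g x := by
  have hφc : HasCompactSupport φ := weight_hasCompactSupport_of_tsupport_subset hφs
  have hgi : IntegrableOn g (closedBall c r) := hg.continuousOn.integrableOn_compact (isCompact_closedBall c r)
  have hzero : ∀ x, x ∉ closedBall c r → φ x ^ 2 * g x = 0 := by
    intro x hx
    have : φ x = 0 := image_eq_zero_of_notMem_tsupport fun h => hx (hφs h)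
    rw [this]; ring
  rw [← setIntegral_eq_integral_of_forall_compl_eq_zero (s := closedBall c r) (fun x hx => hzero x hx)]
  refine setIntegral_mono_on ((integrable_sq_mul_of_hasCompactSupport hφ hφc hg).integrableOn) hgi
    measurableSet_closedBall fun x _ => ?_
  have h1 : φ x ^ 2 ≤ 1 := by
    have := (hφ01 x).1; have := (hφ01 x).2; nlinarith
  calc φ x ^ 2 * g x ≤ 1 * g x := mul_le_mul_of_nonneg_right h1 (hg0 x)
    _ = g x := one_mul _

/-- The gradient of the weighted field `φw`: `∫‖∇(φw)‖² ≤ 2∫φ²‖∇w‖² + 2B_φ² ∫_{B̄(c,r)}|w|²`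
(Leibniz rule, `(a+b)² ≤ 2a² + 2b²`, `∇φ = 0` off `B̄(c,s)`). [folklore] -/
private theorem integral_norm_fderiv_smul_sq_le {φ : (EuclideanSpace ℝ (Fin 3)) → ℝ} (hφ : ContDiff ℝ 1 φ)
    (hφ01 : ∀ x, 0 ≤ φ x ∧ φ x ≤ 1) {c : (EuclideanSpace ℝ (Fin 3))} {s r : ℝ}
    (hφs : tsupport φ ⊆ closedBall c s) (hsr : s ≤ r) {Bφ : ℝ} (hBφ : ∀ x, ‖fderiv ℝ φ x‖ ≤ Bφ)
    {w : (EuclideanSpace ℝ (Fin 3)) → (EuclideanSpace ℝ (Fin 3))} (hw : ContDiff ℝ 1 w) :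
    Integrable (fun x => ‖fderiv ℝ (fun x => φ x • w x) x‖ ^ 2) ∧
    ∫ x, ‖fderiv ℝ (fun x => φ x • w x) x‖ ^ 2 ≤
      2 * (∫ x, φ x ^ 2 * ‖fderiv ℝ w x‖ ^ 2) + 2 * Bφ ^ 2 * ∫ x in closedBall c r, ‖w x‖ ^ 2 := by
  have hφc : HasCompactSupport φ := weight_hasCompactSupport_of_tsupport_subset hφs
  have hφcont : Continuous φ := hφ.continuous
  have hwc : Continuous w := hw.continuous
  have hDw : Continuous (fderiv ℝ w) := hw.continuous_fderiv one_ne_zero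
  have hW1 : ContDiff ℝ 1 (fun x => φ x • w x) := hφ.smul hw
  have hWc : HasCompactSupport (fun x => φ x • w x) := hφc.smul_right
  have hDWc : Continuous (fderiv ℝ (fun x => φ x • w x)) := hW1.continuous_fderiv one_ne_zero
  have hsub : closedBall c s ⊆ closedBall c r := closedBall_subset_closedBall hsr
  have hDφ_zero : ∀ x, x ∉ closedBall c s → fderiv ℝ φ x = 0 := fun x hx =>
    fderiv_of_notMem_tsupport ℝ fun h => hx (hφs h)
  have hc2 : HasCompactSupport (fun x => ‖fderiv ℝ (fun x => φ x • w x) x‖ ^ 2) :=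
    (hWc.fderiv (𝕜 := ℝ)).norm.mono fun x hx => by
      rw [mem_support] at hx ⊢
      intro h0
      exact hx (by rw [h0]; ring)
  have IDW2 : Integrable fun x => ‖fderiv ℝ (fun x => φ x • w x) x‖ ^ 2 :=
    (hDWc.norm.pow 2).integrable_of_hasCompactSupport hc2
  have ID' : Integrable fun x => φ x ^ 2 * ‖fderiv ℝ w x‖ ^ 2 :=
    integrable_sq_mul_of_hasCompactSupport hφcont hφc (hDw.norm.pow 2)
  have IYl : IntegrableOn (fun x => ‖w x‖ ^ 2) (closedBall c r) :=
    (hwc.norm.pow 2).continuousOn.integrableOn_compact (isCompact_closedBall _ _)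
  have Iind : Integrable fun x => (closedBall c r).indicator (fun x => ‖w x‖ ^ 2) x := by
    rw [integrable_indicator_iff measurableSet_closedBall]; exact IYl
  have hpt : ∀ x, ‖fderiv ℝ (fun x => φ x • w x) x‖ ^ 2 ≤
      2 * (φ x ^ 2 * ‖fderiv ℝ w x‖ ^ 2) + 2 * Bφ ^ 2 * (closedBall c r).indicator (fun x => ‖w x‖ ^ 2) x := by
    intro x
    have hφd : DifferentiableAt ℝ φ x := (hφ.differentiable one_ne_zero) x
    have hwd : DifferentiableAt ℝ w x := (hw.differentiable one_ne_zero) x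
    have hDW : fderiv ℝ (fun x => φ x • w x) x = φ x • fderiv ℝ w x + (fderiv ℝ φ x).smulRight (w x) :=
      fderiv_fun_smul hφd hwd
    have hle : ‖fderiv ℝ (fun x => φ x • w x) x‖ ≤ φ x * ‖fderiv ℝ w x‖ + ‖fderiv ℝ φ x‖ * ‖w x‖ := by
      rw [hDW]
      refine (norm_add_le _ _).trans (le_of_eq ?_)
      rw [norm_smul, Real.norm_eq_abs, abs_of_nonneg (hφ01 x).1, ContinuousLinearMap.norm_smulRight_apply]
    have hsq : ‖fderiv ℝ (fun x => φ x • w x) x‖ ^ 2 ≤ (φ x * ‖fderiv ℝ w x‖ + ‖fderiv ℝ φ x‖ * ‖w x‖) ^ 2 :=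
      pow_le_pow_left₀ (norm_nonneg _) hle 2
    by_cases hxB : x ∈ closedBall c s
    · rw [indicator_of_mem (hsub hxB)]
      have h_b : ‖fderiv ℝ φ x‖ * ‖w x‖ ≤ Bφ * ‖w x‖ := mul_le_mul_of_nonneg_right (hBφ x) (norm_nonneg _)
      have h0 : 0 ≤ ‖fderiv ℝ φ x‖ * ‖w x‖ := by positivity
      nlinarith only [hsq, h_b, h0, sq_nonneg (φ x * ‖fderiv ℝ w x‖ - ‖fderiv ℝ φ x‖ * ‖w x‖)]
    · rw [hDφ_zero x hxB, norm_zero, zero_mul, add_zero] at hsq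
      have hind : 0 ≤ 2 * Bφ ^ 2 * (closedBall c r).indicator (fun x => ‖w x‖ ^ 2) x :=
        mul_nonneg (by positivity) (indicator_nonneg (fun y _ => by positivity) _)
      nlinarith only [hsq, hind, sq_nonneg (φ x * ‖fderiv ℝ w x‖)]
  refine ⟨IDW2, ?_⟩
  calc ∫ x, ‖fderiv ℝ (fun x => φ x • w x) x‖ ^ 2
      ≤ ∫ x, (2 * (φ x ^ 2 * ‖fderiv ℝ w x‖ ^ 2) +
          2 * Bφ ^ 2 * (closedBall c r).indicator (fun x => ‖w x‖ ^ 2) x) :=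
        integral_mono IDW2 ((ID'.const_mul _).add (Iind.const_mul _)) hpt
    _ = 2 * (∫ x, φ x ^ 2 * ‖fderiv ℝ w x‖ ^ 2) + 2 * Bφ ^ 2 * ∫ x in closedBall c r, ‖w x‖ ^ 2 := by
        rw [integral_add (ID'.const_mul _) (Iind.const_mul _), integral_const_mul, integral_const_mul,
          integral_indicator measurableSet_closedBall]

/-- **The `U`-term by integration by parts, localized** (Grujić 2009 p. 867, the absorption of the
lower-order terms; Lemarié-Rieusset 2016, proof of Thm. 11.7, the `α`-terms): for `Z = φh` with
`|h| ≤ |w|`, `‖∇h‖ ≤ c_θ‖∇w‖`, and a `C¹` field `Ũ` with `‖Ũ‖ ≤ S`,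
`∫⟪Z, ∇Ũ Z⟫ ≤ 12 c_θ S ‖φw‖₂ ‖φ∇w‖₂ + 6B_φ(S²‖φw‖₂² + ∫_{B̄(c,r)}|w|²)`
(`abs_integral_inner_fderiv_apply_le_of_hasCompactSupport`, Cauchy–Schwarz, AM–GM). [folklore] -/
private theorem integral_inner_smul_fderiv_smul_le {φ : (EuclideanSpace ℝ (Fin 3)) → ℝ} (hφ : ContDiff ℝ 1 φ)
    (hφ01 : ∀ x, 0 ≤ φ x ∧ φ x ≤ 1) {c : (EuclideanSpace ℝ (Fin 3))} {s r : ℝ}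
    (hφs : tsupport φ ⊆ closedBall c s) (hsr : s ≤ r) {Bφ : ℝ} (hBφ0 : 0 ≤ Bφ) (hBφ : ∀ x, ‖fderiv ℝ φ x‖ ≤ Bφ)
    {w h : (EuclideanSpace ℝ (Fin 3)) → (EuclideanSpace ℝ (Fin 3))} (hw : ContDiff ℝ 1 w) (hh : ContDiff ℝ 1 h)
    (hh_le : ∀ x, ‖h x‖ ≤ ‖w x‖) {cθ : ℝ} (hcθ : 0 ≤ cθ) (hDh : ∀ x, ‖fderiv ℝ h x‖ ≤ cθ * ‖fderiv ℝ w x‖)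
    {Ut : (EuclideanSpace ℝ (Fin 3)) → (EuclideanSpace ℝ (Fin 3))} (hUt : ContDiff ℝ 1 Ut) {S : ℝ} (hS0 : 0 ≤ S)
    (hUtS : ∀ x, ‖Ut x‖ ≤ S) :
    ∫ x, ⟪φ x • h x, fderiv ℝ Ut x (φ x • h x)⟫ ≤
      12 * cθ * S * Real.sqrt (∫ x, φ x ^ 2 * ‖w x‖ ^ 2) * Real.sqrt (∫ x, φ x ^ 2 * ‖fderiv ℝ w x‖ ^ 2) +
        6 * Bφ * (S ^ 2 * (∫ x, φ x ^ 2 * ‖w x‖ ^ 2) + ∫ x in closedBall c r, ‖w x‖ ^ 2) := by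
  have hφc : HasCompactSupport φ := weight_hasCompactSupport_of_tsupport_subset hφs
  have hφcont : Continuous φ := hφ.continuous
  have hwc : Continuous w := hw.continuous
  have hDw : Continuous (fderiv ℝ w) := hw.continuous_fderiv one_ne_zero
  have hhc : Continuous h := hh.continuous
  have hsub : closedBall c s ⊆ closedBall c r := closedBall_subset_closedBall hsr
  have hDφ_zero : ∀ x, x ∉ closedBall c s → fderiv ℝ φ x = 0 := fun x hx =>
    fderiv_of_notMem_tsupport ℝ fun h => hx (hφs h)
  set Z : (EuclideanSpace ℝ (Fin 3)) → (EuclideanSpace ℝ (Fin 3)) := fun x => φ x • h x with hZ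
  have hZ1 : ContDiff ℝ 1 Z := hφ.smul hh
  have hZc : HasCompactSupport Z := hφc.smul_right
  have hZcont : Continuous Z := hZ1.continuous
  set Yφ : ℝ := ∫ x, φ x ^ 2 * ‖w x‖ ^ 2 with hYφ
  set D' : ℝ := ∫ x, φ x ^ 2 * ‖fderiv ℝ w x‖ ^ 2 with hD'
  set Yl : ℝ := ∫ x in closedBall c r, ‖w x‖ ^ 2 with hYl
  have IYφ : Integrable fun x => φ x ^ 2 * ‖w x‖ ^ 2 :=
    integrable_sq_mul_of_hasCompactSupport hφcont hφc (hwc.norm.pow 2)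
  have ID' : Integrable fun x => φ x ^ 2 * ‖fderiv ℝ w x‖ ^ 2 :=
    integrable_sq_mul_of_hasCompactSupport hφcont hφc (hDw.norm.pow 2)
  have IYl : IntegrableOn (fun x => ‖w x‖ ^ 2) (closedBall c r) :=
    (hwc.norm.pow 2).continuousOn.integrableOn_compact (isCompact_closedBall _ _)
  have hYφ0 : 0 ≤ Yφ := integral_nonneg fun x => by positivity
  set sY := Real.sqrt Yφ with hsY
  have h1 : |∫ x, ⟪Z x, fderiv ℝ Ut x (Z x)⟫| ≤ 12 * S * ∫ x, ‖Z x‖ * ‖fderiv ℝ Z x‖ :=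
    abs_integral_inner_fderiv_apply_le_of_hasCompactSupport hZ1 hZc hUt hUtS
  -- pointwise: `‖Z‖‖DZ‖ ≤ cθ φ²|w|‖Dw‖ + Bφ 1_{B̄(c,s)} φ |w|²`
  have hZD : ∀ x, ‖Z x‖ * ‖fderiv ℝ Z x‖ ≤
      cθ * (φ x ^ 2 * (‖w x‖ * ‖fderiv ℝ w x‖)) +
        Bφ * (closedBall c s).indicator (fun x => φ x * ‖w x‖ ^ 2) x := by
    intro x
    have hφd : DifferentiableAt ℝ φ x := (hφ.differentiable one_ne_zero) x
    have hhd : DifferentiableAt ℝ h x := (hh.differentiable one_ne_zero) x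
    have hDZ : fderiv ℝ Z x = φ x • fderiv ℝ h x + (fderiv ℝ φ x).smulRight (h x) :=
      fderiv_fun_smul hφd hhd
    have hZx : ‖Z x‖ = φ x * ‖h x‖ := by
      show ‖φ x • h x‖ = _; rw [norm_smul, Real.norm_eq_abs, abs_of_nonneg (hφ01 x).1]
    have hDZle : ‖fderiv ℝ Z x‖ ≤ φ x * (cθ * ‖fderiv ℝ w x‖) + ‖fderiv ℝ φ x‖ * ‖h x‖ := by
      rw [hDZ]
      calc ‖φ x • fderiv ℝ h x + (fderiv ℝ φ x).smulRight (h x)‖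
          ≤ ‖φ x • fderiv ℝ h x‖ + ‖(fderiv ℝ φ x).smulRight (h x)‖ := norm_add_le _ _
        _ = φ x * ‖fderiv ℝ h x‖ + ‖fderiv ℝ φ x‖ * ‖h x‖ := by
            rw [norm_smul, Real.norm_eq_abs, abs_of_nonneg (hφ01 x).1,
              ContinuousLinearMap.norm_smulRight_apply]
        _ ≤ φ x * (cθ * ‖fderiv ℝ w x‖) + ‖fderiv ℝ φ x‖ * ‖h x‖ := by
            have := mul_le_mul_of_nonneg_left (hDh x) (hφ01 x).1
            linarith
    have hφ0 := (hφ01 x).1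
    have hZnn : 0 ≤ φ x * ‖h x‖ := mul_nonneg hφ0 (norm_nonneg _)
    have hprod : ‖Z x‖ * ‖fderiv ℝ Z x‖ ≤
        (φ x * ‖h x‖) * (φ x * (cθ * ‖fderiv ℝ w x‖) + ‖fderiv ℝ φ x‖ * ‖h x‖) := by
      rw [hZx]; exact mul_le_mul_of_nonneg_left hDZle hZnn
    have hA : (φ x * ‖h x‖) * (φ x * (cθ * ‖fderiv ℝ w x‖)) ≤ cθ * (φ x ^ 2 * (‖w x‖ * ‖fderiv ℝ w x‖)) := by
      have := hh_le x
      have h2 : 0 ≤ φ x * (cθ * ‖fderiv ℝ w x‖) := by positivity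
      calc (φ x * ‖h x‖) * (φ x * (cθ * ‖fderiv ℝ w x‖))
          ≤ (φ x * ‖w x‖) * (φ x * (cθ * ‖fderiv ℝ w x‖)) :=
            mul_le_mul_of_nonneg_right (mul_le_mul_of_nonneg_left this hφ0) h2
        _ = cθ * (φ x ^ 2 * (‖w x‖ * ‖fderiv ℝ w x‖)) := by ring
    by_cases hxB : x ∈ closedBall c s
    · rw [indicator_of_mem hxB]
      have hB : (φ x * ‖h x‖) * (‖fderiv ℝ φ x‖ * ‖h x‖) ≤ Bφ * (φ x * ‖w x‖ ^ 2) := by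
        have e1 : φ x * ‖h x‖ ≤ φ x * ‖w x‖ := mul_le_mul_of_nonneg_left (hh_le x) hφ0
        have e2 : ‖fderiv ℝ φ x‖ * ‖h x‖ ≤ Bφ * ‖w x‖ := mul_le_mul (hBφ x) (hh_le x) (norm_nonneg _) hBφ0
        calc (φ x * ‖h x‖) * (‖fderiv ℝ φ x‖ * ‖h x‖) ≤ (φ x * ‖w x‖) * (Bφ * ‖w x‖) :=
              mul_le_mul e1 e2 (by positivity) (by positivity)
          _ = Bφ * (φ x * ‖w x‖ ^ 2) := by ring
      calc ‖Z x‖ * ‖fderiv ℝ Z x‖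
          ≤ (φ x * ‖h x‖) * (φ x * (cθ * ‖fderiv ℝ w x‖) + ‖fderiv ℝ φ x‖ * ‖h x‖) := hprod
        _ = (φ x * ‖h x‖) * (φ x * (cθ * ‖fderiv ℝ w x‖)) + (φ x * ‖h x‖) * (‖fderiv ℝ φ x‖ * ‖h x‖) := by ring
        _ ≤ cθ * (φ x ^ 2 * (‖w x‖ * ‖fderiv ℝ w x‖)) + Bφ * (φ x * ‖w x‖ ^ 2) := add_le_add hA hB
    · rw [indicator_of_notMem hxB, mul_zero, add_zero]
      have hD0 : fderiv ℝ φ x = 0 := hDφ_zero x hxB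
      calc ‖Z x‖ * ‖fderiv ℝ Z x‖
          ≤ (φ x * ‖h x‖) * (φ x * (cθ * ‖fderiv ℝ w x‖) + ‖fderiv ℝ φ x‖ * ‖h x‖) := hprod
        _ = (φ x * ‖h x‖) * (φ x * (cθ * ‖fderiv ℝ w x‖)) := by rw [hD0, norm_zero, zero_mul, add_zero]
        _ ≤ cθ * (φ x ^ 2 * (‖w x‖ * ‖fderiv ℝ w x‖)) := hA
  -- `∫ φ²|w|‖Dw‖ ≤ √Yφ √D'`
  have e2 : (fun x => ‖φ x • w x‖ ^ 2) = fun x => φ x ^ 2 * ‖w x‖ ^ 2 := by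
    funext x; rw [norm_smul, Real.norm_eq_abs, abs_of_nonneg (hφ01 x).1]; ring
  have e3 : (fun x => ‖φ x • fderiv ℝ w x‖ ^ 2) = fun x => φ x ^ 2 * ‖fderiv ℝ w x‖ ^ 2 := by
    funext x; rw [norm_smul, Real.norm_eq_abs, abs_of_nonneg (hφ01 x).1]; ring
  have hcs1 : ∫ x, φ x ^ 2 * (‖w x‖ * ‖fderiv ℝ w x‖) ≤ sY * Real.sqrt D' := by
    have h := integral_norm_mul_norm_le_sqrt (f := fun x => φ x • w x)
      (g := fun x => φ x • fderiv ℝ w x) (hφcont.smul hwc) (hφcont.smul hDw)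
      (by rw [e2]; exact IYφ) (by rw [e3]; exact ID')
    have e1 : (fun x => ‖φ x • w x‖ * ‖φ x • fderiv ℝ w x‖) =
        fun x => φ x ^ 2 * (‖w x‖ * ‖fderiv ℝ w x‖) := by
      funext x
      rw [norm_smul, norm_smul, Real.norm_eq_abs, abs_of_nonneg (hφ01 x).1]; ring
    rw [e1, e2, e3] at h
    exact h
  -- the indicator term: `2 S ∫ 1_{B̄} φ|w|² ≤ S² Yφ + Yl`
  have Iind : Integrable fun x => (closedBall c s).indicator (fun x => φ x * ‖w x‖ ^ 2) x := by
    rw [integrable_indicator_iff measurableSet_closedBall]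
    exact ((hφcont.mul (hwc.norm.pow 2)).continuousOn.integrableOn_compact (isCompact_closedBall _ _))
  have Iind6 : Integrable fun x => (closedBall c r).indicator (fun x => ‖w x‖ ^ 2) x := by
    rw [integrable_indicator_iff measurableSet_closedBall]; exact IYl
  have hind_le : 2 * S * ∫ x, (closedBall c s).indicator (fun x => φ x * ‖w x‖ ^ 2) x ≤ S ^ 2 * Yφ + Yl := by
    have hpt : ∀ x, 2 * S * (closedBall c s).indicator (fun x => φ x * ‖w x‖ ^ 2) x ≤
        S ^ 2 * (φ x ^ 2 * ‖w x‖ ^ 2) + (closedBall c r).indicator (fun x => ‖w x‖ ^ 2) x := by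
      intro x
      by_cases hxB : x ∈ closedBall c s
      · rw [indicator_of_mem hxB, indicator_of_mem (hsub hxB)]
        nlinarith only [sq_nonneg (S * φ x * ‖w x‖ - ‖w x‖), sq_nonneg (‖w x‖), (hφ01 x).1, hS0]
      · rw [indicator_of_notMem hxB, mul_zero]
        have : 0 ≤ (closedBall c r).indicator (fun x => ‖w x‖ ^ 2) x :=
          indicator_nonneg (fun y _ => by positivity) _
        positivity
    calc 2 * S * ∫ x, (closedBall c s).indicator (fun x => φ x * ‖w x‖ ^ 2) x
        = ∫ x, 2 * S * (closedBall c s).indicator (fun x => φ x * ‖w x‖ ^ 2) x := by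
          rw [integral_const_mul]
      _ ≤ ∫ x, (S ^ 2 * (φ x ^ 2 * ‖w x‖ ^ 2) + (closedBall c r).indicator (fun x => ‖w x‖ ^ 2) x) :=
          integral_mono (Iind.const_mul _) ((IYφ.const_mul _).add Iind6) hpt
      _ = S ^ 2 * Yφ + Yl := by
          rw [integral_add (IYφ.const_mul _) Iind6, integral_const_mul,
            integral_indicator measurableSet_closedBall]
  have IZD : Integrable fun x => ‖Z x‖ * ‖fderiv ℝ Z x‖ :=
    (hZcont.norm.mul (hZ1.continuous_fderiv one_ne_zero).norm).integrable_of_hasCompactSupport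
      (hZc.norm.mul_right)
  have IwDw : Integrable fun x => φ x ^ 2 * (‖w x‖ * ‖fderiv ℝ w x‖) :=
    integrable_sq_mul_of_hasCompactSupport hφcont hφc (hwc.norm.mul hDw.norm)
  have h2 : ∫ x, ‖Z x‖ * ‖fderiv ℝ Z x‖ ≤
      cθ * (sY * Real.sqrt D') + Bφ * ∫ x, (closedBall c s).indicator (fun x => φ x * ‖w x‖ ^ 2) x := by
    calc ∫ x, ‖Z x‖ * ‖fderiv ℝ Z x‖
        ≤ ∫ x, (cθ * (φ x ^ 2 * (‖w x‖ * ‖fderiv ℝ w x‖)) +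
            Bφ * (closedBall c s).indicator (fun x => φ x * ‖w x‖ ^ 2) x) :=
          integral_mono IZD ((IwDw.const_mul _).add (Iind.const_mul _)) hZD
      _ = cθ * (∫ x, φ x ^ 2 * (‖w x‖ * ‖fderiv ℝ w x‖)) +
            Bφ * ∫ x, (closedBall c s).indicator (fun x => φ x * ‖w x‖ ^ 2) x := by
          rw [integral_add (IwDw.const_mul _) (Iind.const_mul _), integral_const_mul, integral_const_mul]
      _ ≤ cθ * (sY * Real.sqrt D') +
            Bφ * ∫ x, (closedBall c s).indicator (fun x => φ x * ‖w x‖ ^ 2) x := by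
          have := mul_le_mul_of_nonneg_left hcs1 hcθ
          linarith
  have hind0 : 0 ≤ ∫ x, (closedBall c s).indicator (fun x => φ x * ‖w x‖ ^ 2) x :=
    integral_nonneg fun x => indicator_nonneg (fun y _ => mul_nonneg (hφ01 y).1 (sq_nonneg _)) _
  have hS12 : 0 ≤ 12 * S := by positivity
  calc ∫ x, ⟪Z x, fderiv ℝ Ut x (Z x)⟫ ≤ |∫ x, ⟪Z x, fderiv ℝ Ut x (Z x)⟫| := le_abs_self _
    _ ≤ 12 * S * ∫ x, ‖Z x‖ * ‖fderiv ℝ Z x‖ := h1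
    _ ≤ 12 * S * (cθ * (sY * Real.sqrt D') +
          Bφ * ∫ x, (closedBall c s).indicator (fun x => φ x * ‖w x‖ ^ 2) x) :=
        mul_le_mul_of_nonneg_left h2 hS12
    _ = 12 * cθ * S * sY * Real.sqrt D' +
          6 * Bφ * (2 * S * ∫ x, (closedBall c s).indicator (fun x => φ x * ‖w x‖ ^ 2) x) := by ring
    _ ≤ 12 * cθ * S * sY * Real.sqrt D' + 6 * Bφ * (S ^ 2 * Yφ + Yl) := by
        have e := mul_le_mul_of_nonneg_left hind_le (by positivity : (0:ℝ) ≤ 6 * Bφ)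
        linarith

set_option maxHeartbeats 1600000 in
/-- **The depleted high term, localized** (Grujić 2009, (8) and the chain "Hölder (in `x`) with the
exponents 4, 4 and 2, and then the weak Young … followed by interpolating", p. 867; here in the
tree's Lorentz/HLS-free form: two-radii Riesz bound at `δ = (1 + ‖w‖_{L²(B̄)})⁻¹`, Cauchy–Schwarz
`∫φ⁴|w|⁴ ≤ ‖φw‖₂‖φw‖₆³`, Sobolev on `φw`): if `|G| ≤ φ² A |w|² ∫|x−y|^{-5/2}|f|` pointwise with
`|f| ≤ |w|` supported in `B̄(c,r)`, then
`∫G ≤ A(c_n (‖w‖_{L²(B̄)}‖φw‖₂)^{1/2} t³ + c_f (1 + ‖w‖_{L²(B̄)})‖w‖_{L²(B̄)}‖φw‖₂²)` with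
`t² = K √(2‖φ∇w‖₂² + 2B_φ²‖w‖²_{L²(B̄)})`. [folklore] -/
private theorem integral_highTerm_le {φ : (EuclideanSpace ℝ (Fin 3)) → ℝ} (hφ : ContDiff ℝ 1 φ)
    (hφ01 : ∀ x, 0 ≤ φ x ∧ φ x ≤ 1) {c : (EuclideanSpace ℝ (Fin 3))} {s r : ℝ}
    (hφs : tsupport φ ⊆ closedBall c s) (hsr : s ≤ r) {Bφ : ℝ} (hBφ : ∀ x, ‖fderiv ℝ φ x‖ ≤ Bφ)
    {w f : (EuclideanSpace ℝ (Fin 3)) → (EuclideanSpace ℝ (Fin 3))} (hw : ContDiff ℝ 1 w)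
    (hf : Continuous f) (hfc : HasCompactSupport f) (hf_le : ∀ y, ‖f y‖ ≤ ‖w y‖)
    (hf0 : ∀ y, y ∉ closedBall c r → f y = 0)
    {G : (EuclideanSpace ℝ (Fin 3)) → ℝ} (hGi : Integrable G) {AM : ℝ} (hAM : 0 ≤ AM)
    (hGpt : ∀ x, |G x| ≤ φ x ^ 2 * (AM * ‖w x‖ ^ 2 * ∫ y, ‖x - y‖ ^ (-(5 / 2 : ℝ)) * ‖f y‖)) :
    ∫ x, G x ≤ AM *
      ((6 * (volume : Measure (EuclideanSpace ℝ (Fin 3))).real (ball 0 1)) *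
          Real.sqrt (Real.sqrt (∫ x in closedBall c r, ‖w x‖ ^ 2) * Real.sqrt (∫ x, φ x ^ 2 * ‖w x‖ ^ 2)) *
          Real.sqrt ((((SNormLESNormFDerivOfEqConst (EuclideanSpace ℝ (Fin 3))
              (volume : Measure (EuclideanSpace ℝ (Fin 3))) 2 : ℝ≥0) : ℝ) + 1) *
            Real.sqrt (2 * (∫ x, φ x ^ 2 * ‖fderiv ℝ w x‖ ^ 2) +
              2 * Bφ ^ 2 * ∫ x in closedBall c r, ‖w x‖ ^ 2)) ^ 3 +
        Real.sqrt (3 * (volume : Measure (EuclideanSpace ℝ (Fin 3))).real (ball 0 1) / 2) *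
          ((1 + Real.sqrt (∫ x in closedBall c r, ‖w x‖ ^ 2)) *
            Real.sqrt (∫ x in closedBall c r, ‖w x‖ ^ 2) * (∫ x, φ x ^ 2 * ‖w x‖ ^ 2))) := by
  -- constants
  set K₀ : ℝ≥0 := SNormLESNormFDerivOfEqConst (EuclideanSpace ℝ (Fin 3)) (volume : Measure (EuclideanSpace ℝ (Fin 3))) 2 with hK₀
  set K : ℝ := (K₀ : ℝ) + 1 with hK
  have hK0 : 0 < K := by rw [hK]; positivity
  set v₁ : ℝ := (volume : Measure (EuclideanSpace ℝ (Fin 3))).real (ball 0 1) with hv₁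
  have hv₁0 : 0 ≤ v₁ := measureReal_nonneg
  set cn : ℝ := 6 * v₁ with hcn
  have hcn0 : 0 ≤ cn := by positivity
  set cf : ℝ := Real.sqrt (3 * v₁ / 2) with hcf
  have hcf0 : 0 ≤ cf := Real.sqrt_nonneg _
  -- basic objects
  have hφc : HasCompactSupport φ := weight_hasCompactSupport_of_tsupport_subset hφs
  have hφcont : Continuous φ := hφ.continuous
  have hwc : Continuous w := hw.continuous
  have hDw : Continuous (fderiv ℝ w) := hw.continuous_fderiv one_ne_zero
  -- quantities
  set Yφ : ℝ := ∫ x, φ x ^ 2 * ‖w x‖ ^ 2 with hYφ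
  set D' : ℝ := ∫ x, φ x ^ 2 * ‖fderiv ℝ w x‖ ^ 2 with hD'
  set Yl : ℝ := ∫ x in closedBall c r, ‖w x‖ ^ 2 with hYl
  have IYφ : Integrable fun x => φ x ^ 2 * ‖w x‖ ^ 2 :=
    integrable_sq_mul_of_hasCompactSupport hφcont hφc (hwc.norm.pow 2)
  have IYl : IntegrableOn (fun x => ‖w x‖ ^ 2) (closedBall c r) :=
    (hwc.norm.pow 2).continuousOn.integrableOn_compact (isCompact_closedBall _ _)
  have hYφ0 : 0 ≤ Yφ := integral_nonneg fun x => by positivity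
  have hD'0 : 0 ≤ D' := integral_nonneg fun x => by positivity
  have hYl0 : 0 ≤ Yl := setIntegral_nonneg measurableSet_closedBall fun x _ => by positivity
  set X2 : ℝ := 2 * D' + 2 * Bφ ^ 2 * Yl with hX2
  have hX20 : 0 ≤ X2 := by positivity
  set sY : ℝ := Real.sqrt Yφ with hsY
  set sL : ℝ := Real.sqrt Yl with hsL
  set sX : ℝ := Real.sqrt X2 with hsX
  have hsY0 : 0 ≤ sY := Real.sqrt_nonneg _
  have hsL0 : 0 ≤ sL := Real.sqrt_nonneg _
  have hsX0 : 0 ≤ sX := Real.sqrt_nonneg _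
  have hKsX : 0 ≤ K * sX := mul_nonneg hK0.le hsX0
  set t : ℝ := Real.sqrt (K * sX) with htdef
  have ht0 : 0 ≤ t := Real.sqrt_nonneg _
  set q : ℝ := Real.sqrt (sL * sY) with hqdef
  have hq0 : 0 ≤ q := Real.sqrt_nonneg _
  have hq2 : q ^ 2 = sL * sY := Real.sq_sqrt (mul_nonneg hsL0 hsY0)
  show ∫ x, G x ≤ AM * (cn * q * t ^ 3 + cf * ((1 + sL) * sL * Yφ))
  -- the weighted field `W = φ w`
  set W : (EuclideanSpace ℝ (Fin 3)) → (EuclideanSpace ℝ (Fin 3)) := fun x => φ x • w x with hW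
  have hW1 : ContDiff ℝ 1 W := hφ.smul hw
  have hWc : HasCompactSupport W := hφc.smul_right
  have hWcont : Continuous W := hW1.continuous
  have hDWc : Continuous (fderiv ℝ W) := hW1.continuous_fderiv one_ne_zero
  have hWnorm : ∀ x, ‖W x‖ = φ x * ‖w x‖ := fun x => by
    show ‖φ x • w x‖ = _; rw [norm_smul, Real.norm_eq_abs, abs_of_nonneg (hφ01 x).1]
  have IW2 : Integrable fun x => ‖W x‖ ^ 2 := by
    have e : (fun x => ‖W x‖ ^ 2) = fun x => φ x ^ 2 * ‖w x‖ ^ 2 := by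
      funext x; rw [hWnorm x]; ring
    rw [e]; exact IYφ
  have hW2 : ∫ x, ‖W x‖ ^ 2 = Yφ := by
    rw [hYφ]; exact integral_congr_ae (Eventually.of_forall fun x => by
      show ‖W x‖ ^ 2 = φ x ^ 2 * ‖w x‖ ^ 2; rw [hWnorm x]; ring)
  have hWm2 : MemLp W 2 volume := (memLp_two_iff_integrable_sq_norm hWcont.aestronglyMeasurable).2 IW2
  obtain ⟨IDW2, hDW2⟩ := integral_norm_fderiv_smul_sq_le hφ hφ01 hφs hsr hBφ hw
  have hDWm2 : MemLp (fderiv ℝ W) 2 volume :=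
    (memLp_two_iff_integrable_sq_norm hDWc.aestronglyMeasurable).2 IDW2
  have hDW2' : (eLpNorm (fderiv ℝ W) 2 volume).toReal ≤ sX := by
    rw [toReal_eLpNorm_two_eq_sqrt hDWc IDW2, hsX]
    exact Real.sqrt_le_sqrt hDW2
  -- Sobolev `‖W‖₆ ≤ K ‖DW‖₂ ≤ K sX`
  have hsob := eLpNorm_six_le_eLpNorm_fderiv_two (volume : Measure (EuclideanSpace ℝ (Fin 3)))
    (F := (EuclideanSpace ℝ (Fin 3))) finrank_euclideanSpace_fin hW1 hWm2.eLpNorm_lt_top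
  have hDW_eq : eLpNorm (fderiv ℝ W) 2 volume = ENNReal.ofReal ((eLpNorm (fderiv ℝ W) 2 volume).toReal) :=
    (ENNReal.ofReal_toReal hDWm2.eLpNorm_lt_top.ne).symm
  have hK₀K : (K₀ : ℝ≥0∞) ≤ ENNReal.ofReal K := by
    rw [hK, show ((K₀ : ℝ) + 1 : ℝ) = ((K₀ + 1 : ℝ≥0) : ℝ) by push_cast; ring,
      ENNReal.ofReal_coe_nnreal]
    exact_mod_cast le_self_add
  have hW6e : eLpNorm W 6 volume ≤ ENNReal.ofReal (K * sX) := by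
    refine hsob.trans ?_
    rw [hDW_eq, ENNReal.ofReal_mul hK0.le]
    exact mul_le_mul' hK₀K (ENNReal.ofReal_le_ofReal hDW2')
  -- (i) `∫ G ≤ ∫ |G| = (∫⁻ ‖G‖ₑ).toReal`
  have h1 : ∫ x, G x ≤ ∫ x, ‖G x‖ := integral_mono hGi hGi.norm fun x => le_abs_self _
  rw [integral_norm_eq_lintegral_enorm hGi.aestronglyMeasurable] at h1
  -- (ii) the `ℝ≥0∞` objects
  set Φ : (EuclideanSpace ℝ (Fin 3)) → ℝ≥0∞ := fun x => ‖W x‖ₑ ^ 2 with hΦ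
  set Fh : (EuclideanSpace ℝ (Fin 3)) → ℝ≥0∞ := fun y => ‖f y‖ₑ with hFh
  have hΦm : Measurable Φ := hWcont.measurable.enorm.pow_const 2
  have hFm : Measurable Fh := hf.measurable.enorm
  set Pe : (EuclideanSpace ℝ (Fin 3)) → ℝ≥0∞ := fun x =>
    ∫⁻ y, Fh y * ENNReal.ofReal (‖x - y‖ ^ (-(5 / 2 : ℝ))) with hPe
  have hPint : ∀ x, Integrable fun y => ‖x - y‖ ^ (-(5 / 2 : ℝ)) * ‖f y‖ :=
    fun x => integrable_rieszHalfKernel_mul_norm' hf hfc x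
  have hPeq : ∀ x, ENNReal.ofReal (∫ y, ‖x - y‖ ^ (-(5 / 2 : ℝ)) * ‖f y‖) = Pe x := by
    intro x
    rw [ofReal_integral_eq_lintegral_ofReal (hPint x) (Eventually.of_forall fun y =>
      mul_nonneg (Real.rpow_nonneg (norm_nonneg _) _) (norm_nonneg _))]
    refine lintegral_congr fun y => ?_
    rw [ENNReal.ofReal_mul (Real.rpow_nonneg (norm_nonneg _) _), ofReal_norm, mul_comm]
  have hpt : ∀ x, ‖G x‖ₑ ≤ ENNReal.ofReal AM * (Φ x * Pe x) := by
    intro x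
    rw [Real.enorm_eq_ofReal_abs]
    refine (ENNReal.ofReal_le_ofReal (hGpt x)).trans (le_of_eq ?_)
    have e : φ x ^ 2 * (AM * ‖w x‖ ^ 2 * ∫ y, ‖x - y‖ ^ (-(5 / 2 : ℝ)) * ‖f y‖) =
        AM * (‖W x‖ ^ 2 * ∫ y, ‖x - y‖ ^ (-(5 / 2 : ℝ)) * ‖f y‖) := by
      rw [hWnorm x]; ring
    rw [e, ENNReal.ofReal_mul hAM, ENNReal.ofReal_mul (by positivity : 0 ≤ ‖W x‖ ^ 2), hPeq x, hΦ]
    simp only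
    rw [ENNReal.ofReal_pow (norm_nonneg _), ofReal_norm]
  have h2 : ∫⁻ x, ‖G x‖ₑ ≤ ENNReal.ofReal AM * ∫⁻ x, Φ x * Pe x := by
    calc ∫⁻ x, ‖G x‖ₑ ≤ ∫⁻ x, ENNReal.ofReal AM * (Φ x * Pe x) := lintegral_mono hpt
      _ = ENNReal.ofReal AM * ∫⁻ x, Φ x * Pe x := lintegral_const_mul' _ _ ENNReal.ofReal_ne_top
  -- (iii) two radii at `δ = (1 + sL)⁻¹`
  set δ : ℝ := (1 + sL)⁻¹ with hδ
  have hδ0 : 0 < δ := by rw [hδ]; positivity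
  have h3 := lintegral_mul_rieszHalfPotential_le_two_radii hΦm hFm hδ0
  -- (iv) sizes
  have hΦ1 : ∫⁻ x, Φ x = ENNReal.ofReal Yφ := by
    rw [← hW2, ofReal_integral_eq_lintegral_ofReal IW2 (Eventually.of_forall fun x => sq_nonneg _)]
    refine lintegral_congr fun x => ?_
    rw [hΦ]; simp only
    rw [ENNReal.ofReal_pow (norm_nonneg _), ofReal_norm]
  have hF2 : ∫⁻ y, Fh y ^ 2 ≤ ENNReal.ofReal Yl := by
    have hle : ∀ y, Fh y ^ 2 ≤ (closedBall c r).indicator (fun y => ENNReal.ofReal (‖w y‖ ^ 2)) y := by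
      intro y
      by_cases hy : y ∈ closedBall c r
      · rw [indicator_of_mem hy, hFh]; simp only
        rw [← ofReal_norm, ← ENNReal.ofReal_pow (norm_nonneg _)]
        exact ENNReal.ofReal_le_ofReal (pow_le_pow_left₀ (norm_nonneg _) (hf_le y) 2)
      · rw [indicator_of_notMem hy, hFh]; simp only
        rw [hf0 y hy]; simp
    calc ∫⁻ y, Fh y ^ 2 ≤ ∫⁻ y, (closedBall c r).indicator (fun y => ENNReal.ofReal (‖w y‖ ^ 2)) y :=
          lintegral_mono hle
      _ = ∫⁻ y in closedBall c r, ENNReal.ofReal (‖w y‖ ^ 2) := lintegral_indicator measurableSet_closedBall _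
      _ = ENNReal.ofReal Yl := by
          rw [hYl, ofReal_integral_eq_lintegral_ofReal IYl (Eventually.of_forall fun y => sq_nonneg _)]
  have hF2r : (∫⁻ y, Fh y ^ 2) ^ (1 / 2 : ℝ) ≤ ENNReal.ofReal sL := by
    refine (ENNReal.rpow_le_rpow hF2 (by norm_num)).trans (le_of_eq ?_)
    rw [ENNReal.ofReal_rpow_of_nonneg hYl0 (by norm_num), hsL, Real.sqrt_eq_rpow]
  have hΦ2 : ∫⁻ x, Φ x ^ 2 ≤ ENNReal.ofReal (sY * (K * sX) ^ 3) := by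
    have hcs := ENNReal.lintegral_mul_le_Lp_mul_Lq volume Real.HolderConjugate.two_two
      (hWcont.measurable.enorm).aemeasurable ((hWcont.measurable.enorm).pow_const 3).aemeasurable
    simp only [Pi.mul_apply] at hcs
    have e2 : ∀ (Gf : (EuclideanSpace ℝ (Fin 3)) → ℝ≥0∞), ∫⁻ x, Gf x ^ (2 : ℝ) = ∫⁻ x, Gf x ^ 2 :=
      fun Gf => lintegral_congr fun x => by
        rw [show (2 : ℝ) = ((2 : ℕ) : ℝ) by norm_num, ENNReal.rpow_natCast]
    rw [e2, e2] at hcs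
    have hlhs : ∫⁻ x, Φ x ^ 2 = ∫⁻ x, ‖W x‖ₑ * ‖W x‖ₑ ^ 3 :=
      lintegral_congr fun x => by rw [hΦ]; simp only; ring
    have hY2 : (∫⁻ x, ‖W x‖ₑ ^ 2) ^ (1 / (2 : ℝ)) = ENNReal.ofReal sY := by
      have : ∫⁻ x, ‖W x‖ₑ ^ 2 = ENNReal.ofReal Yφ := hΦ1
      rw [this, ENNReal.ofReal_rpow_of_nonneg hYφ0 (by norm_num), hsY, Real.sqrt_eq_rpow]
    have h6 : ∫⁻ x, (‖W x‖ₑ ^ 3) ^ 2 ≤ ENNReal.ofReal (K * sX) ^ (6 : ℝ) := by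
      have hrepr := eLpNorm_eq_lintegral_rpow_enorm_toReal (μ := volume) (f := W)
        (by norm_num : (6 : ℝ≥0∞) ≠ 0) (by norm_num : (6 : ℝ≥0∞) ≠ ⊤)
      have h6r : (6 : ℝ≥0∞).toReal = 6 := by norm_num
      rw [h6r] at hrepr
      have hI : ∫⁻ x, ‖W x‖ₑ ^ (6 : ℝ) = eLpNorm W 6 volume ^ (6 : ℝ) := by
        rw [hrepr, ← ENNReal.rpow_mul]; norm_num
      have hpt6 : ∀ x, (‖W x‖ₑ ^ 3) ^ 2 = ‖W x‖ₑ ^ (6 : ℝ) := fun x => by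
        rw [← pow_mul, show (6 : ℝ) = ((6 : ℕ) : ℝ) by norm_num, ENNReal.rpow_natCast]
      simp_rw [hpt6]
      rw [hI]
      exact ENNReal.rpow_le_rpow hW6e (by norm_num)
    have h6r : (∫⁻ x, (‖W x‖ₑ ^ 3) ^ 2) ^ (1 / (2 : ℝ)) ≤ ENNReal.ofReal ((K * sX) ^ 3) := by
      refine (ENNReal.rpow_le_rpow h6 (by norm_num)).trans (le_of_eq ?_)
      rw [← ENNReal.rpow_mul, show (6 : ℝ) * (1 / 2) = ((3 : ℕ) : ℝ) by norm_num,
        ENNReal.rpow_natCast, ENNReal.ofReal_pow hKsX]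
    rw [hlhs]
    calc ∫⁻ x, ‖W x‖ₑ * ‖W x‖ₑ ^ 3
        ≤ (∫⁻ x, ‖W x‖ₑ ^ 2) ^ (1 / (2 : ℝ)) * (∫⁻ x, (‖W x‖ₑ ^ 3) ^ 2) ^ (1 / (2 : ℝ)) := hcs
      _ ≤ ENNReal.ofReal sY * ENNReal.ofReal ((K * sX) ^ 3) := by
          rw [hY2]; exact mul_le_mul_right h6r _
      _ = ENNReal.ofReal (sY * (K * sX) ^ 3) := (ENNReal.ofReal_mul hsY0).symm
  have hΦ2r : (∫⁻ x, Φ x ^ 2) ^ (1 / 2 : ℝ) ≤ ENNReal.ofReal (Real.sqrt (sY * (K * sX) ^ 3)) := by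
    refine (ENNReal.rpow_le_rpow hΦ2 (by norm_num)).trans (le_of_eq ?_)
    rw [ENNReal.ofReal_rpow_of_nonneg (by positivity) (by norm_num), Real.sqrt_eq_rpow]
  -- (v) assemble in `ℝ≥0∞`, pass to `ℝ`
  set Wr : ℝ := cn * Real.sqrt δ * (Real.sqrt (sY * (K * sX) ^ 3) * sL) + cf / δ * sL * Yφ with hWr
  have hWr0 : 0 ≤ Wr := by positivity
  have h4 : ∫⁻ x, Φ x * Pe x ≤ ENNReal.ofReal Wr := by
    refine h3.trans ?_
    have ha' : ENNReal.ofReal (6 * v₁ * Real.sqrt δ) *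
        ((∫⁻ x, Φ x ^ 2) ^ (1 / 2 : ℝ) * (∫⁻ y, Fh y ^ 2) ^ (1 / 2 : ℝ)) ≤
        ENNReal.ofReal (cn * Real.sqrt δ * (Real.sqrt (sY * (K * sX) ^ 3) * sL)) := by
      rw [ENNReal.ofReal_mul (by positivity : 0 ≤ cn * Real.sqrt δ),
        ENNReal.ofReal_mul (Real.sqrt_nonneg _), hcn]
      exact mul_le_mul_right (mul_le_mul' hΦ2r hF2r) _
    have hb : ENNReal.ofReal (Real.sqrt (3 * v₁ / 2) / δ) * (∫⁻ y, Fh y ^ 2) ^ (1 / 2 : ℝ) *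
        (∫⁻ x, Φ x) ≤ ENNReal.ofReal (cf / δ * sL * Yφ) := by
      rw [hΦ1, ENNReal.ofReal_mul (by positivity : 0 ≤ cf / δ * sL),
        ENNReal.ofReal_mul (by positivity : 0 ≤ cf / δ), hcf]
      exact mul_le_mul_left (mul_le_mul_right hF2r _) _
    calc _ ≤ ENNReal.ofReal (cn * Real.sqrt δ * (Real.sqrt (sY * (K * sX) ^ 3) * sL)) +
          ENNReal.ofReal (cf / δ * sL * Yφ) := add_le_add ha' hb
      _ = ENNReal.ofReal Wr := by rw [hWr, ENNReal.ofReal_add (by positivity) (by positivity)]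
  have h5 : (∫⁻ x, ‖G x‖ₑ).toReal ≤ AM * Wr := by
    have h := h2.trans (mul_le_mul_right h4 _)
    rw [← ENNReal.ofReal_mul hAM] at h
    have h' := ENNReal.toReal_mono ENNReal.ofReal_ne_top h
    rwa [ENNReal.toReal_ofReal (by positivity)] at h'
  -- (vi) the choice of `δ`
  have hWle : Wr ≤ cn * q * t ^ 3 + cf * ((1 + sL) * sL * Yφ) := by
    have ht3 : Real.sqrt ((K * sX) ^ 3) = t ^ 3 := by
      rw [htdef, show (K * sX) ^ 3 = (K * sX) ^ 2 * (K * sX) by ring,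
        Real.sqrt_mul (by positivity), Real.sqrt_sq hKsX]
      rw [show Real.sqrt (K * sX) ^ 3 = Real.sqrt (K * sX) ^ 2 * Real.sqrt (K * sX) by ring,
        Real.sq_sqrt hKsX]
    have hδq : Real.sqrt δ * Real.sqrt sY * sL ≤ q := by
      have hsq : (Real.sqrt δ * Real.sqrt sY * sL) ^ 2 ≤ q ^ 2 := by
        rw [hq2, mul_pow, mul_pow, Real.sq_sqrt hδ0.le, Real.sq_sqrt hsY0]
        have hfrac : δ * sL ≤ 1 := by
          rw [hδ, inv_mul_le_iff₀ (by positivity : (0 : ℝ) < 1 + sL)]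
          linarith
        calc δ * sY * sL ^ 2 = (δ * sL) * (sL * sY) := by ring
          _ ≤ 1 * (sL * sY) := mul_le_mul_of_nonneg_right hfrac (mul_nonneg hsL0 hsY0)
          _ = sL * sY := one_mul _
      exact (pow_le_pow_iff_left₀ (by positivity) hq0 two_ne_zero).1 hsq
    have hnear : cn * Real.sqrt δ * (Real.sqrt (sY * (K * sX) ^ 3) * sL) ≤ cn * q * t ^ 3 := by
      rw [Real.sqrt_mul hsY0, ht3]
      have hct : 0 ≤ cn * t ^ 3 := by positivity
      calc cn * Real.sqrt δ * (Real.sqrt sY * t ^ 3 * sL)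
          = (cn * t ^ 3) * (Real.sqrt δ * Real.sqrt sY * sL) := by ring
        _ ≤ (cn * t ^ 3) * q := mul_le_mul_of_nonneg_left hδq hct
        _ = cn * q * t ^ 3 := by ring
    have hδinv : cf / δ = cf * (1 + sL) := by rw [hδ, div_inv_eq_mul]
    rw [hWr, hδinv]
    have e2 : cf * (1 + sL) * sL * Yφ = cf * ((1 + sL) * sL * Yφ) := by ring
    rw [e2]
    linarith only [hnear]
  calc ∫ x, G x ≤ (∫⁻ x, ‖G x‖ₑ).toReal := h1
    _ ≤ AM * Wr := h5
    _ ≤ AM * (cn * q * t ^ 3 + cf * ((1 + sL) * sL * Yφ)) := mul_le_mul_of_nonneg_left hWle hAM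


/-! ### The geometric depletion for the cut-off high part under the Hölder hypothesis -/

/-- **Depleted self-stretching of the high vorticity cut off to a ball, ½-Hölder form** (Grujić
2009, (8): after localization and the coherence hypothesis the kernel of `T₃ʰ` is
`|x−y|^{-5/2} ψ(y)|ω|(y)`; Beirão da Veiga–Berselli 2002, (4.6) for the whole space). There is an
absolute `A ≥ 0` such that: for a `C¹` field `w`, its high part `w_hi = (1 − θ_R(w)) w` (`R > 0`),
a threshold `Ω ≤ R`, `M ≥ 0`, a `C¹` compactly supported weight `χ ≥ 0` supported inside a set `O`
on which the direction hypothesis `√(1 − ⟪ξ(x), ξ(y)⟫²) ≤ M |x−y|^{1/2}` holds for all pairs with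
`|w(x)|, |w(y)| > Ω`, one has at every `x ∈ O`, with `f = χ w_hi`,
`|⟪w_hi(x), ∇(K ∗ f)(x) w_hi(x)⟫| ≤ A M |w(x)|² ∫ |x−y|^{-5/2} |f(y)| dy`.
Proof: `exists_abs_inner_fderiv_biotSavart_le` with the direction `e = ξ(x)` (to which both
`w_hi(x)` and `f(x)` are parallel) and the majorant `A M |x−y|^{-5/2}|f(y)|`
(`norm_highPart_sub_inner_smul_le`). [cite: Grujic2009, Thm. 1 proof (8) (p. 867); BeiraodaveigaBerselli2002, Lemma 4.1 proof (4.6)] -/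
theorem exists_abs_inner_highPart_fderiv_biotSavart_cutoff_le_holder :
    ∃ A : ℝ, 0 ≤ A ∧ ∀ ⦃w : (EuclideanSpace ℝ (Fin 3)) → (EuclideanSpace ℝ (Fin 3))⦄
      (_ : ContDiff ℝ 1 w) ⦃R Ω M : ℝ⦄ (_ : 0 < R) (_ : Ω ≤ R) (_ : 0 ≤ M)
      ⦃χ : (EuclideanSpace ℝ (Fin 3)) → ℝ⦄ (_ : ContDiff ℝ 1 χ) (_ : HasCompactSupport χ) (_ : ∀ y, 0 ≤ χ y)
      ⦃O : Set (EuclideanSpace ℝ (Fin 3))⦄ (_ : support χ ⊆ O)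
      (_ : ∀ x ∈ O, ∀ y ∈ O, Ω < ‖w x‖ → Ω < ‖w y‖ →
        Real.sqrt (1 - ⟪vorticityDirection w x, vorticityDirection w y⟫ ^ 2) ≤
          M * Real.sqrt ‖x - y‖) ⦃x : (EuclideanSpace ℝ (Fin 3))⦄ (_ : x ∈ O),
      |⟪(1 - radialCutoff R (2 * R) (w x)) • w x,
        fderiv ℝ (biotSavart fun y => χ y • ((1 - radialCutoff R (2 * R) (w y)) • w y)) x
          ((1 - radialCutoff R (2 * R) (w x)) • w x)⟫| ≤
        A * M * ‖w x‖ ^ 2 *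
          ∫ y, ‖x - y‖ ^ (-(5 / 2 : ℝ)) * ‖χ y • ((1 - radialCutoff R (2 * R) (w y)) • w y)‖ := by
  obtain ⟨A, hA0, hdep⟩ := exists_abs_inner_fderiv_biotSavart_le
  refine ⟨A, hA0, ?_⟩
  intro w hw R Ω M hR hΩR hM χ hχ hχc hχ0 O hχO hdir x hxO
  set hi : (EuclideanSpace ℝ (Fin 3)) → (EuclideanSpace ℝ (Fin 3)) :=
    fun y => (1 - radialCutoff R (2 * R) (w y)) • w y with hhi
  set f : (EuclideanSpace ℝ (Fin 3)) → (EuclideanSpace ℝ (Fin 3)) := fun y => χ y • hi y with hf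
  have hhi1 : ContDiff ℝ 1 hi := contDiff_highPart hw R
  have hf1 : ContDiff ℝ 1 f := hχ.smul hhi1
  have hfc : HasCompactSupport f := hχc.smul_right
  have hfcont : Continuous f := hf1.continuous
  set P : ℝ := ∫ y, ‖x - y‖ ^ (-(5 / 2 : ℝ)) * ‖f y‖ with hP
  have hP0 : 0 ≤ P := integral_nonneg fun y =>
    mul_nonneg (Real.rpow_nonneg (norm_nonneg _) _) (norm_nonneg _)
  show |⟪hi x, fderiv ℝ (biotSavart f) x (hi x)⟫| ≤ A * M * ‖w x‖ ^ 2 * P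
  by_cases hx : hi x = 0
  · rw [hx, inner_zero_left, abs_zero]
    positivity
  -- the direction at `x`
  have hwR : R < ‖w x‖ := lt_norm_of_highPart_ne_zero hR hx
  have hw0 : w x ≠ 0 := by
    intro h; rw [h, norm_zero] at hwR; exact lt_irrefl _ (hR.trans hwR)
  have hxΩ : Ω < ‖w x‖ := hΩR.trans_lt hwR
  set e : (EuclideanSpace ℝ (Fin 3)) := vorticityDirection w x with he
  have he1 : ‖e‖ = 1 := norm_vorticityDirection w hw0
  set c : ℝ := (1 - radialCutoff R (2 * R) (w x)) * ‖w x‖ with hc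
  have hhix : hi x = c • e := highPart_eq_smul_vorticityDirection w R x
  have hc0 : 0 ≤ c := mul_nonneg (sub_nonneg.2 (radialCutoff_le_one _ _ _)) (norm_nonneg _)
  have hcle : c ≤ ‖w x‖ :=
    mul_le_of_le_one_left (norm_nonneg _) (sub_le_self _ (radialCutoff_nonneg _ _ _))
  have hfx : f x = (χ x * c) • e := by
    show χ x • hi x = (χ x * c) • e
    rw [hhix, smul_smul]
  -- Hölder continuity of `f`
  obtain ⟨Cl, hCl⟩ := hf1.lipschitzWith_of_hasCompactSupport hfc one_ne_zero
  have hhol : HolderWith Cl 1 f := hCl.holderWith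
  -- the depleted majorant
  set g : (EuclideanSpace ℝ (Fin 3)) → ℝ := fun y => A * M * (‖x - y‖ ^ (-(5 / 2 : ℝ)) * ‖f y‖)
    with hg
  have hgi : Integrable g := (integrable_rieszHalfKernel_mul_norm' hfcont hfc x).const_mul (A * M)
  have hg0 : ∀ y, 0 ≤ g y := fun y => by
    rw [hg]; exact mul_nonneg (mul_nonneg hA0 hM)
      (mul_nonneg (Real.rpow_nonneg (norm_nonneg _) _) (norm_nonneg _))
  have hdom : ∀ y, y ≠ x → A * ‖f y - ⟪f y, e⟫ • e‖ * (‖x - y‖ ^ 3)⁻¹ ≤ g y := by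
    intro y hyx
    have hr : 0 < ‖x - y‖ := norm_pos_iff.2 (sub_ne_zero.2 (Ne.symm hyx))
    -- `f y − ⟪f y, e⟫ e = χ y • (hi y − ⟪hi y, e⟫ e)`
    have hfac : f y - ⟪f y, e⟫ • e = χ y • (hi y - ⟪hi y, e⟫ • e) := by
      show χ y • hi y - ⟪χ y • hi y, e⟫ • e = χ y • (hi y - ⟪hi y, e⟫ • e)
      rw [real_inner_smul_left, smul_sub, mul_smul]
    by_cases hχy : χ y = 0
    · rw [hfac, hχy, zero_smul, norm_zero, mul_zero, zero_mul]
      exact hg0 y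
    · have hyO : y ∈ O := hχO (mem_support.2 hχy)
      have hle : ‖hi y - ⟪hi y, e⟫ • e‖ ≤ ‖hi y‖ * min 1 (M * Real.sqrt ‖x - y‖) := by
        refine norm_highPart_sub_inner_smul_le hR he1 fun hyR => ?_
        exact hdir x hxO y hyO hxΩ (hΩR.trans_lt hyR)
      have hle' : ‖hi y - ⟪hi y, e⟫ • e‖ ≤ ‖hi y‖ * (M * Real.sqrt ‖x - y‖) :=
        hle.trans (mul_le_mul_of_nonneg_left (min_le_right _ _) (norm_nonneg _))
      have hnf : ‖f y - ⟪f y, e⟫ • e‖ ≤ ‖f y‖ * (M * Real.sqrt ‖x - y‖) := by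
        rw [hfac, norm_smul, Real.norm_eq_abs, abs_of_nonneg (hχ0 y)]
        have hfy : ‖f y‖ = χ y * ‖hi y‖ := by
          show ‖χ y • hi y‖ = χ y * ‖hi y‖
          rw [norm_smul, Real.norm_eq_abs, abs_of_nonneg (hχ0 y)]
        rw [hfy, mul_assoc]
        exact mul_le_mul_of_nonneg_left hle' (hχ0 y)
      rw [hg]
      calc A * ‖f y - ⟪f y, e⟫ • e‖ * (‖x - y‖ ^ 3)⁻¹
          ≤ A * (‖f y‖ * (M * Real.sqrt ‖x - y‖)) * (‖x - y‖ ^ 3)⁻¹ := by gcongr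
        _ = A * M * ((Real.sqrt ‖x - y‖ * (‖x - y‖ ^ 3)⁻¹) * ‖f y‖) := by ring
        _ = A * M * (‖x - y‖ ^ (-(5 / 2 : ℝ)) * ‖f y‖) := by rw [sqrt_mul_inv_cube' hr]
  have hkey := hdep one_pos hhol hfc he1 ⟨χ x * c, hfx⟩ hgi hdom
  -- assemble
  have hinner : ⟪hi x, fderiv ℝ (biotSavart f) x (hi x)⟫ =
      c ^ 2 * ⟪e, fderiv ℝ (biotSavart f) x e⟫ := by
    rw [hhix, map_smul, real_inner_smul_left, real_inner_smul_right]
    ring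
  rw [hinner, abs_mul, abs_of_nonneg (sq_nonneg c)]
  have hint_le : ∫ y, g y = A * M * P := by
    rw [hg, integral_const_mul]
  calc c ^ 2 * |⟪e, fderiv ℝ (biotSavart f) x e⟫| ≤ ‖w x‖ ^ 2 * (A * M * P) :=
        mul_le_mul (pow_le_pow_left₀ hc0 hcle 2) (hkey.trans hint_le.le) (abs_nonneg _)
          (sq_nonneg _)
    _ = A * M * ‖w x‖ ^ 2 * P := by ring

/-! ### The final count -/

/-- **The final count of the localized estimate** (Young's inequality twice and `√Y ≤ 1 + Y`;
Grujić 2009, pp. 867–868, "Collecting the estimates on `T₁, T₂, T₃ˡ` and `T₃ʰ`"): the arithmetic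
turning the bounds of the low terms, of the integration by parts and of the depleted high term
into `2(T_E + T_B + T_G) ≤ νD + (C₁ + C₂(Y+F) + C₃E)Yφ + C₄(Y+F)`. [cite: Grujic2009, Thm. 1 proof (pp. 867–868, collecting the estimates)] -/
theorem localized_stretching_count
    {ν Ω A M cn cf K cθ Bφ σ a Yφ Dφ Yl Fl El TE TB TG S' q t : ℝ}
    (hν : 0 < ν) (hK : 0 < K) (hA : 0 ≤ A) (hM : 0 ≤ M) (hcn : 0 ≤ cn) (hcf : 0 ≤ cf)
    (hBφ : 0 ≤ Bφ)
    (hYφ : 0 ≤ Yφ) (hDφ : 0 ≤ Dφ) (hYl : 0 ≤ Yl) (hFl : 0 ≤ Fl)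
    (hq : 0 ≤ q) (hq4 : q ^ 4 = Yl * Yφ) (ht : 0 ≤ t) (ht4 : t ^ 4 = K ^ 2 * (2 * Dφ + 2 * Bφ ^ 2 * Yl))
    (hS' : S' ^ 2 ≤ 4 * (σ ^ 2 + a ^ 2 * (Yl + Fl + El)))
    (hTE : 2 * TE ≤ 8 * Ω * (Fl + Yl))
    (hTB : TB ≤ 12 * cθ * S' * Real.sqrt Yφ * Real.sqrt Dφ + 6 * Bφ * (S' ^ 2 * Yφ + Yl))
    (hTG : TG ≤ A * M * (cn * q * t ^ 3 + cf * ((1 + Real.sqrt Yl) * Real.sqrt Yl * Yφ))) :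
    2 * (TE + (TB + TG)) ≤
      ν * Dφ +
        ((4 * (576 * cθ ^ 2 / ν + 12 * Bφ) * σ ^ 2 + 2 * A * M * cf) +
          (4 * (576 * cθ ^ 2 / ν + 12 * Bφ) * a ^ 2 + 864 * K ^ 6 * (A * M * cn) ^ 4 / ν ^ 3 +
            4 * A * M * cf) * (Yl + Fl) +
          (4 * (576 * cθ ^ 2 / ν + 12 * Bφ) * a ^ 2) * El) * Yφ +
        (8 * Ω + 12 * Bφ + ν * Bφ ^ 2 / 4) * (Yl + Fl) := by
  -- the target in expanded form
  set κ₀ : ℝ := 576 * cθ ^ 2 / ν + 12 * Bφ with hκ₀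
  set CG : ℝ := 864 * K ^ 6 * (A * M * cn) ^ 4 / ν ^ 3 with hCG
  have hκ₀0 : 0 ≤ κ₀ := by positivity
  have hCG0 : 0 ≤ CG := by positivity
  have etarget : ν * Dφ +
        ((4 * κ₀ * σ ^ 2 + 2 * A * M * cf) + (4 * κ₀ * a ^ 2 + CG + 4 * A * M * cf) * (Yl + Fl) +
          (4 * κ₀ * a ^ 2) * El) * Yφ + (8 * Ω + 12 * Bφ + ν * Bφ ^ 2 / 4) * (Yl + Fl) =
      ν * Dφ + (4 * κ₀ * σ ^ 2 + 2 * A * M * cf) * Yφ + (4 * κ₀ * a ^ 2 + CG + 4 * A * M * cf) * ((Yl + Fl) * Yφ) +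
        4 * κ₀ * a ^ 2 * (El * Yφ) + (8 * Ω + 12 * Bφ + ν * Bφ ^ 2 / 4) * (Yl + Fl) := by ring
  rw [etarget]
  -- abbreviations
  set sY : ℝ := Real.sqrt Yφ with hsY
  set sD : ℝ := Real.sqrt Dφ with hsD
  set sL : ℝ := Real.sqrt Yl with hsL
  have hsY0 : 0 ≤ sY := Real.sqrt_nonneg _
  have hsD0 : 0 ≤ sD := Real.sqrt_nonneg _
  have hsL0 : 0 ≤ sL := Real.sqrt_nonneg _
  have hsY2 : sY ^ 2 = Yφ := Real.sq_sqrt hYφ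
  have hsD2 : sD ^ 2 = Dφ := Real.sq_sqrt hDφ
  have hsL2 : sL ^ 2 = Yl := Real.sq_sqrt hYl
  set P : ℝ := (Yl + Fl) * Yφ with hP
  set Q : ℝ := El * Yφ with hQ
  set YY : ℝ := Yl * Yφ with hYY
  set SY : ℝ := S' ^ 2 * Yφ with hSY
  have hP0 : 0 ≤ P := by positivity
  have hFY : YY ≤ P := by
    have e : P = YY + Fl * Yφ := by rw [hP, hYY]; ring
    have : 0 ≤ Fl * Yφ := by positivity
    linarith only [e, this]
  -- ### group B
  have hyB : 2 * (sD * (12 * cθ * S' * sY)) ≤ ν / 4 * Dφ + 576 * cθ ^ 2 / ν * SY := by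
    have h : 0 ≤ (ν / 4) * (sD - 4 / ν * (12 * cθ * S' * sY)) ^ 2 := by positivity
    have e : (ν / 4) * (sD - 4 / ν * (12 * cθ * S' * sY)) ^ 2 =
        ν / 4 * sD ^ 2 + 4 / ν * (12 * cθ * S' * sY) ^ 2 - 2 * (sD * (12 * cθ * S' * sY)) := by
      field_simp
      ring
    have e1 : 4 / ν * (12 * cθ * S' * sY) ^ 2 = 576 * cθ ^ 2 / ν * SY := by
      rw [show (12 * cθ * S' * sY) ^ 2 = 144 * cθ ^ 2 * S' ^ 2 * sY ^ 2 by ring, hsY2, hSY]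
      field_simp
      ring
    rw [hsD2, e1] at e
    linarith only [h, e]
  have gB : 2 * TB ≤ ν / 4 * Dφ + κ₀ * SY + 12 * Bφ * Yl := by
    have e : κ₀ * SY = 576 * cθ ^ 2 / ν * SY + 12 * Bφ * SY := by rw [hκ₀]; ring
    have h0 : 2 * TB ≤ 2 * (sD * (12 * cθ * S' * sY)) + 12 * Bφ * SY + 12 * Bφ * Yl := by
      have e2 : 2 * (12 * cθ * S' * sY * sD) = 2 * (sD * (12 * cθ * S' * sY)) := by ring
      have e3 : 2 * (6 * Bφ * (SY + Yl)) = 12 * Bφ * SY + 12 * Bφ * Yl := by ring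
      linarith only [hTB, e2, e3]
    linarith only [hyB, h0, e]
  have gB' : κ₀ * SY ≤ 4 * κ₀ * σ ^ 2 * Yφ + 4 * κ₀ * a ^ 2 * P + 4 * κ₀ * a ^ 2 * Q := by
    have h2 : SY ≤ 4 * (σ ^ 2 + a ^ 2 * (Yl + Fl + El)) * Yφ := by
      rw [hSY]; exact mul_le_mul_of_nonneg_right hS' hYφ
    have h4 := mul_le_mul_of_nonneg_left h2 hκ₀0
    have e : κ₀ * (4 * (σ ^ 2 + a ^ 2 * (Yl + Fl + El)) * Yφ) =
        4 * κ₀ * σ ^ 2 * Yφ + 4 * κ₀ * a ^ 2 * P + 4 * κ₀ * a ^ 2 * Q := by rw [hP, hQ]; ring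
    linarith only [h4, e]
  -- ### group G
  have hnear : 2 * (A * M * (cn * q * t ^ 3)) ≤ ν / 4 * Dφ + ν / 4 * Bφ ^ 2 * Yl + CG * YY := by
    set α : ℝ := A * M * cn * q with hα
    have hα0 : 0 ≤ α := by positivity
    set ε : ℝ := ν / (8 * K ^ 2) with hε
    have hε0 : 0 < ε := by positivity
    have hyoung := two_mul_mul_cube_le' hε0 hα0 ht
    have e1 : 2 * (A * M * (cn * q * t ^ 3)) = 2 * α * t ^ 3 := by rw [hα]; ring
    have e2 : ε * t ^ 4 = ν / 4 * Dφ + ν / 4 * Bφ ^ 2 * Yl := by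
      rw [hε, ht4]; field_simp; ring
    have hα4 : α ^ 4 = (A * M * cn) ^ 4 * YY := by rw [hα, mul_pow, hq4, hYY]
    have hε3 : ε ^ 3 = ν ^ 3 / (512 * K ^ 6) := by rw [hε]; ring
    have e3 : 27 * α ^ 4 / (16 * ε ^ 3) = CG * YY := by
      rw [hα4, hε3, hCG]
      field_simp
      ring
    linarith only [hyoung, e1, e2, e3]
  have hfar : 2 * (A * M * (cf * ((1 + sL) * sL * Yφ))) ≤ 2 * A * M * cf * Yφ + 4 * A * M * cf * YY := by
    have h1 : (1 + sL) * sL ≤ 1 + 2 * Yl := by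
      have e : (1 + sL) * sL = sL + Yl := by rw [← hsL2]; ring
      rw [e]; nlinarith only [sq_nonneg (sL - 1), hsL2, hYl]
    have h2 : (1 + sL) * sL * Yφ ≤ (1 + 2 * Yl) * Yφ := mul_le_mul_of_nonneg_right h1 hYφ
    have h3 : 0 ≤ 2 * A * M * cf := by positivity
    have h4 := mul_le_mul_of_nonneg_left h2 h3
    have e1 : 2 * (A * M * (cf * ((1 + sL) * sL * Yφ))) = 2 * A * M * cf * ((1 + sL) * sL * Yφ) := by ring
    have e2 : 2 * A * M * cf * ((1 + 2 * Yl) * Yφ) = 2 * A * M * cf * Yφ + 4 * A * M * cf * YY := by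
      rw [hYY]; ring
    linarith only [h4, e1, e2]
  have gG : 2 * TG ≤ ν / 4 * Dφ + ν / 4 * Bφ ^ 2 * Yl + CG * YY + 2 * A * M * cf * Yφ + 4 * A * M * cf * YY := by
    have e : 2 * (A * M * (cn * q * t ^ 3 + cf * ((1 + sL) * sL * Yφ))) =
        2 * (A * M * (cn * q * t ^ 3)) + 2 * (A * M * (cf * ((1 + sL) * sL * Yφ))) := by ring
    have h0 : 2 * TG ≤ 2 * (A * M * (cn * q * t ^ 3 + cf * ((1 + sL) * sL * Yφ))) := by linarith only [hTG]
    linarith only [h0, e, hnear, hfar]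
  -- ### monotonicity in `Yl ≤ Yl + Fl`
  have hco1 : CG * YY ≤ CG * P := mul_le_mul_of_nonneg_left hFY hCG0
  have hco2 : 4 * A * M * cf * YY ≤ 4 * A * M * cf * P := mul_le_mul_of_nonneg_left hFY (by positivity)
  have hco3 : 8 * Ω * (Fl + Yl) + 12 * Bφ * Yl + ν / 4 * Bφ ^ 2 * Yl ≤
      (8 * Ω + 12 * Bφ + ν * Bφ ^ 2 / 4) * (Yl + Fl) := by
    have e : (8 * Ω + 12 * Bφ + ν * Bφ ^ 2 / 4) * (Yl + Fl) =
        8 * Ω * (Fl + Yl) + 12 * Bφ * Yl + ν / 4 * Bφ ^ 2 * Yl + (12 * Bφ + ν * Bφ ^ 2 / 4) * Fl := by ring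
    have : 0 ≤ (12 * Bφ + ν * Bφ ^ 2 / 4) * Fl := by positivity
    linarith only [e, this]
  have hνD : ν / 4 * Dφ + ν / 4 * Dφ ≤ ν * Dφ := by nlinarith only [hν, hDφ]
  linarith only [gB, gB', gG, hco1, hco2, hco3, hνD, hTE]

/-! ### The localized stretching estimate -/

/-- Cauchy–Schwarz on a closed ball: `∫_B h ≤ √(vol B) √(∫_B h²)` for a continuous `h ≥ 0`. [folklore] -/
private theorem setIntegral_closedBall_le_sqrt_vol_mul_sqrt {h : (EuclideanSpace ℝ (Fin 3)) → ℝ} (hh : Continuous h)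
    (h0 : ∀ x, 0 ≤ h x) (c : (EuclideanSpace ℝ (Fin 3))) (r : ℝ) :
    ∫ x in closedBall c r, h x ≤
      Real.sqrt ((volume : Measure (EuclideanSpace ℝ (Fin 3))).real (closedBall c r)) *
        Real.sqrt (∫ x in closedBall c r, h x ^ 2) := by
  set μ : Measure (EuclideanSpace ℝ (Fin 3)) :=
    (volume : Measure (EuclideanSpace ℝ (Fin 3))).restrict (closedBall c r) with hμ
  haveI : IsFiniteMeasure μ := isFiniteMeasure_restrict.2 (measure_closedBall_lt_top).ne
  obtain ⟨M, hM⟩ := (isCompact_closedBall c r).exists_bound_of_continuousOn hh.continuousOn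
  have hmem1 : MemLp (fun _ : (EuclideanSpace ℝ (Fin 3)) => (1 : ℝ)) (ENNReal.ofReal 2) μ := memLp_const 1
  have hbd : ∀ᵐ x ∂μ, h x ∈ Icc (-M) M := by
    refine ae_restrict_of_forall_mem measurableSet_closedBall fun x hx => ?_
    have hx' := hM x hx
    rw [Real.norm_eq_abs] at hx'
    exact ⟨by linarith [neg_abs_le (h x)], (le_abs_self _).trans hx'⟩
  have hmemh : MemLp h (ENNReal.ofReal 2) μ := memLp_of_bounded hbd hh.aestronglyMeasurable _
  have hcs := integral_mul_le_Lp_mul_Lq_of_nonneg (μ := μ) Real.HolderConjugate.two_two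
    (f := fun _ => (1 : ℝ)) (g := h) (ae_of_all _ fun _ => zero_le_one) (ae_of_all _ h0) hmem1 hmemh
  have e1 : ∫ _a, (1 : ℝ) ^ (2 : ℝ) ∂μ = (volume : Measure (EuclideanSpace ℝ (Fin 3))).real (closedBall c r) := by
    simp only [Real.one_rpow, integral_const, smul_eq_mul, mul_one]
    rw [hμ, measureReal_restrict_apply_univ]
  have e2 : ∫ a, h a ^ (2 : ℝ) ∂μ = ∫ x in closedBall c r, h x ^ 2 := by
    rw [hμ]
    refine integral_congr_ae (Eventually.of_forall fun x => ?_)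
    simp only [Real.rpow_two]
  have e3 : ∫ a, (1 : ℝ) * h a ∂μ = ∫ x in closedBall c r, h x := by
    rw [hμ]
    refine integral_congr_ae (Eventually.of_forall fun x => ?_)
    simp only [one_mul]
  rw [e1, e2, e3] at hcs
  rw [Real.sqrt_eq_rpow, Real.sqrt_eq_rpow]
  exact hcs

set_option maxHeartbeats 3200000 in
/-- **The localized stretching estimate under local ½-Hölder coherence** (Grujić 2009, Thm. 1,
the estimate of `T₃ = T₃ˡ + T₃ʰ` at a fixed time, pp. 866–868; the localized twin of
`exists_two_mul_integral_stretching_le_of_holderHalf`). Fix a centre `c`, a radius `s > 0`, a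
weight `φ ∈ C¹(ℝ³)` with `0 ≤ φ ≤ 1` and `tsupport φ ⊆ B̄(c, s)`, and `ν, Ω > 0`, `Mh ∈ ℝ`. There
are `C₁, …, C₄ ≥ 0` such that for every `V ∈ C²(ℝ³; ℝ³)` which is divergence free on `B(c, 6s)`
and whose vorticity direction `ξ = ω/|ω|`, `ω = curl V`, satisfies
`√(1 − ⟪ξ(x), ξ(y)⟫²) ≤ Mh |x − y|^{1/2}` for all `x, y ∈ B(c, 6s)` with `|ω(x)|, |ω(y)| > Ω`:
`2 ∫ φ²⟪ω, (∇V)ω⟫ ≤ ν ∫ φ²|∇ω|²_F + (C₁ + C₂ (Y + F) + C₃ E) ∫ φ²|ω|² + C₄ (Y + F)`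
with `Y = ∫_{B̄(c,6s)} |ω|²`, `F = ∫_{B̄(c,6s)} ‖∇V‖²`, `E = ∫_{B̄(c,6s)} |V|²`. See the module
docstring for the proof and its deviations from print. [cite: Grujic2009, Thm. 1 (p. 866) with proof §5 pp. 866–868 ((8), Hölder 4,4,2, weak Young, interpolation); BeiraodaveigaBerselli2002, Lemma 4.1 proof (4.1)–(4.12)] -/
theorem exists_localized_stretching_le_of_holderHalf (c : (EuclideanSpace ℝ (Fin 3))) {s ν Ω : ℝ}
    (hs : 0 < s) (hν : 0 < ν) (hΩ : 0 < Ω) (Mh : ℝ)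
    {φ : (EuclideanSpace ℝ (Fin 3)) → ℝ} (hφ : ContDiff ℝ 1 φ) (hφ01 : ∀ x, 0 ≤ φ x ∧ φ x ≤ 1)
    (hφs : tsupport φ ⊆ closedBall c s) :
    ∃ C₁ C₂ C₃ C₄ : ℝ, 0 ≤ C₁ ∧ 0 ≤ C₂ ∧ 0 ≤ C₃ ∧ 0 ≤ C₄ ∧
      ∀ ⦃V : (EuclideanSpace ℝ (Fin 3)) → (EuclideanSpace ℝ (Fin 3))⦄ (_ : ContDiff ℝ 2 V)
        (_ : ∀ y ∈ ball c (6 * s), VectorCalculus.divergence V y = 0)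
        (_ : ∀ x ∈ ball c (6 * s), ∀ y ∈ ball c (6 * s), Ω < ‖curl V x‖ → Ω < ‖curl V y‖ →
          Real.sqrt (1 - ⟪vorticityDirection (curl V) x, vorticityDirection (curl V) y⟫ ^ 2) ≤
            Mh * Real.sqrt ‖x - y‖),
        2 * ∫ x, φ x ^ 2 * ⟪curl V x, fderiv ℝ V x (curl V x)⟫ ≤
          ν * (∫ x, φ x ^ 2 * frobeniusNormSq (fderiv ℝ (curl V) x)) +
            (C₁ + C₂ * ((∫ x in closedBall c (6 * s), ‖curl V x‖ ^ 2) +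
                (∫ x in closedBall c (6 * s), ‖fderiv ℝ V x‖ ^ 2)) +
              C₃ * (∫ x in closedBall c (6 * s), ‖V x‖ ^ 2)) * (∫ x, φ x ^ 2 * ‖curl V x‖ ^ 2) +
            C₄ * ((∫ x in closedBall c (6 * s), ‖curl V x‖ ^ 2) +
              (∫ x in closedBall c (6 * s), ‖fderiv ℝ V x‖ ^ 2)) := by
  -- ### universal constants
  obtain ⟨A, hA0, hdep⟩ := exists_abs_inner_highPart_fderiv_biotSavart_cutoff_le_holder
  obtain ⟨CF, hCF0, hsupF⟩ := exists_norm_sub_biotSavart_ballCutoff_le c hs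
  obtain ⟨Bθ, hBθ0, hBθ⟩ := exists_norm_fderiv_radialCutoff_le
  set K₀ : ℝ≥0 := SNormLESNormFDerivOfEqConst (EuclideanSpace ℝ (Fin 3))
    (volume : Measure (EuclideanSpace ℝ (Fin 3))) 2 with hK₀
  set K : ℝ := (K₀ : ℝ) + 1 with hK
  have hK0 : 0 < K := by rw [hK]; positivity
  set cθ : ℝ := 1 + 2 * Bθ with hcθdef
  have hcθ0 : 0 ≤ cθ := by positivity
  set v₁ : ℝ := (volume : Measure (EuclideanSpace ℝ (Fin 3))).real (ball 0 1) with hv₁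
  have hv₁0 : 0 ≤ v₁ := measureReal_nonneg
  set cn : ℝ := 6 * v₁ with hcn
  have hcn0 : 0 ≤ cn := by positivity
  set cf : ℝ := Real.sqrt (3 * v₁ / 2) with hcf
  have hcf0 : 0 ≤ cf := Real.sqrt_nonneg _
  set M : ℝ := max Mh 0 with hMdef'
  have hM0 : 0 ≤ M := le_max_right _ _
  have hMhM : Mh ≤ M := le_max_left _ _
  -- the weight: compact support and a gradient bound
  have hφc : HasCompactSupport φ := weight_hasCompactSupport_of_tsupport_subset hφs
  have hφcont : Continuous φ := hφ.continuous
  obtain ⟨Bφ', hBφ'⟩ := (hφ.continuous_fderiv one_ne_zero).bounded_above_of_compact_support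
    (hφc.fderiv (𝕜 := ℝ))
  set Bφ : ℝ := max Bφ' 0 with hBφdef
  have hBφ0 : 0 ≤ Bφ := le_max_right _ _
  have hBφ : ∀ x, ‖fderiv ℝ φ x‖ ≤ Bφ := fun x => (hBφ' x).trans (le_max_left _ _)
  -- the measure of the big ball and the constants of the sup bound
  set m : ℝ := (volume : Measure (EuclideanSpace ℝ (Fin 3))).real (closedBall c (6 * s)) with hm
  have hm0 : 0 ≤ m := measureReal_nonneg
  set σ : ℝ := 120 * Ω * s with hσ
  set a : ℝ := CF * Real.sqrt m with hadef
  have ha0 : 0 ≤ a := by positivity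
  refine ⟨4 * (576 * cθ ^ 2 / ν + 12 * Bφ) * σ ^ 2 + 2 * A * M * cf,
    4 * (576 * cθ ^ 2 / ν + 12 * Bφ) * a ^ 2 + 864 * K ^ 6 * (A * M * cn) ^ 4 / ν ^ 3 + 4 * A * M * cf,
    4 * (576 * cθ ^ 2 / ν + 12 * Bφ) * a ^ 2, 8 * Ω + 12 * Bφ + ν * Bφ ^ 2 / 4,
    by positivity, by positivity, by positivity, by positivity, ?_⟩
  intro V hV hdiv hdir
  -- ### basic objects
  have hV1 : ContDiff ℝ 1 V := hV.of_le (by norm_num)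
  have hVc : Continuous V := hV.continuous
  have hDV : Continuous (fderiv ℝ V) := hV.continuous_fderiv (by norm_num)
  have hω1 : ContDiff ℝ 1 (curl V) := contDiff_curl (n := 1) (by exact hV)
  have hωc : Continuous (curl V) := hω1.continuous
  have hDω : Continuous (fderiv ℝ (curl V)) := hω1.continuous_fderiv one_ne_zero
  -- geometry of the balls
  have h2s : 0 < 2 * s := by positivity
  have hs6 : s ≤ 6 * s := by linarith
  have hφx : ∀ x, φ x ≠ 0 → x ∈ closedBall c s := fun x hx => hφs (subset_tsupport _ (mem_support.2 hx))
  have hsub1 : closedBall c s ⊆ ball c (6 * s) := fun x hx => by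
    rw [mem_closedBall] at hx; rw [mem_ball]; linarith
  have hsub2 : closedBall c s ⊆ closedBall c (6 * s) := closedBall_subset_closedBall hs6
  have hsub3 : ball c (6 * s) ⊆ closedBall c (6 * s) := ball_subset_closedBall
  -- ### the quantities
  set Yφ : ℝ := ∫ x, φ x ^ 2 * ‖curl V x‖ ^ 2 with hYφ
  set Dφ : ℝ := ∫ x, φ x ^ 2 * frobeniusNormSq (fderiv ℝ (curl V) x) with hDφdef
  set D' : ℝ := ∫ x, φ x ^ 2 * ‖fderiv ℝ (curl V) x‖ ^ 2 with hD'
  set Yl : ℝ := ∫ x in closedBall c (6 * s), ‖curl V x‖ ^ 2 with hYl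
  set Fl : ℝ := ∫ x in closedBall c (6 * s), ‖fderiv ℝ V x‖ ^ 2 with hFl
  set El : ℝ := ∫ x in closedBall c (6 * s), ‖V x‖ ^ 2 with hEl
  have IDφ : Integrable fun x => φ x ^ 2 * frobeniusNormSq (fderiv ℝ (curl V) x) :=
    integrable_sq_mul_of_hasCompactSupport hφcont hφc (continuous_frobeniusNormSq_fderiv hω1 one_ne_zero)
  have ID' : Integrable fun x => φ x ^ 2 * ‖fderiv ℝ (curl V) x‖ ^ 2 :=
    integrable_sq_mul_of_hasCompactSupport hφcont hφc (hDω.norm.pow 2)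
  have IYl : IntegrableOn (fun x => ‖curl V x‖ ^ 2) (closedBall c (6 * s)) :=
    (hωc.norm.pow 2).continuousOn.integrableOn_compact (isCompact_closedBall _ _)
  have IFl : IntegrableOn (fun x => ‖fderiv ℝ V x‖ ^ 2) (closedBall c (6 * s)) :=
    (hDV.norm.pow 2).continuousOn.integrableOn_compact (isCompact_closedBall _ _)
  have hYφ0 : 0 ≤ Yφ := integral_nonneg fun x => by positivity
  have hDφ0 : 0 ≤ Dφ := integral_nonneg fun x => mul_nonneg (sq_nonneg _) (frobeniusNormSq_nonneg _)
  have hD'0 : 0 ≤ D' := integral_nonneg fun x => by positivity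
  have hYl0 : 0 ≤ Yl := setIntegral_nonneg measurableSet_closedBall fun x _ => by positivity
  have hFl0 : 0 ≤ Fl := setIntegral_nonneg measurableSet_closedBall fun x _ => by positivity
  have hEl0 : 0 ≤ El := setIntegral_nonneg measurableSet_closedBall fun x _ => by positivity
  have hD'D : D' ≤ Dφ := integral_mono ID' IDφ fun x =>
    mul_le_mul_of_nonneg_left (sq_opNorm_le_frobeniusNormSq _) (sq_nonneg _)
  set sY : ℝ := Real.sqrt Yφ with hsY
  set sL : ℝ := Real.sqrt Yl with hsL
  set sF : ℝ := Real.sqrt Fl with hsF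
  set sE : ℝ := Real.sqrt El with hsE
  have hsY0 : 0 ≤ sY := Real.sqrt_nonneg _
  have hsL0 : 0 ≤ sL := Real.sqrt_nonneg _
  have hsF0 : 0 ≤ sF := Real.sqrt_nonneg _
  have hsE0 : 0 ≤ sE := Real.sqrt_nonneg _
  have hsL2 : sL ^ 2 = Yl := Real.sq_sqrt hYl0
  have hsF2 : sF ^ 2 = Fl := Real.sq_sqrt hFl0
  have hsE2 : sE ^ 2 = El := Real.sq_sqrt hEl0
  -- ### splitting
  set R : ℝ := 2 * Ω with hRdef
  have hR : 0 < R := by positivity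
  have hΩR : Ω ≤ R := by linarith
  set lo : (EuclideanSpace ℝ (Fin 3)) → (EuclideanSpace ℝ (Fin 3)) :=
    fun y => radialCutoff R (2 * R) (curl V y) • curl V y with hlo
  set hi : (EuclideanSpace ℝ (Fin 3)) → (EuclideanSpace ℝ (Fin 3)) :=
    fun y => (1 - radialCutoff R (2 * R) (curl V y)) • curl V y with hhi
  have hlohi : ∀ y, curl V y = lo y + hi y := fun y => smul_add_one_sub_smul.symm
  have hlo_le : ∀ y, ‖lo y‖ ≤ 2 * R := fun y => norm_lowPart_le hR y
  have hhi_le : ∀ y, ‖hi y‖ ≤ ‖curl V y‖ := fun y => norm_highPart_le_norm (curl V) R y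
  have hhi1 : ContDiff ℝ 1 hi := contDiff_highPart hω1 R
  have hhicont : Continuous hi := hhi1.continuous
  have hlocont : Continuous lo := (contDiff_lowPart hω1 R).continuous
  have hDhi_le : ∀ y, ‖fderiv ℝ hi y‖ ≤ cθ * ‖fderiv ℝ (curl V) y‖ := fun y =>
    norm_fderiv_highPart_le hω1 hBθ0 hBθ hR y
  -- the ball cutoff `χ` and the cut-off high part `f = χ hi`
  have hχ1 : ContDiff ℝ 1 (ballCutoff c (2 * s)) := contDiff_ballCutoff c (2 * s)
  have hχc : HasCompactSupport (ballCutoff c (2 * s)) := hasCompactSupport_ballCutoff h2s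
  have hχ01 : ∀ y, 0 ≤ ballCutoff c (2 * s) y ∧ ballCutoff c (2 * s) y ≤ 1 := fun y =>
    ⟨ballCutoff_nonneg _ _ _, ballCutoff_le_one _ _ _⟩
  have hχO : support (ballCutoff c (2 * s)) ⊆ ball c (6 * s) := by
    intro y hy
    by_contra h
    rw [mem_ball, dist_eq_norm, not_lt] at h
    exact hy (ballCutoff_eq_zero h2s (by linarith))
  set f : (EuclideanSpace ℝ (Fin 3)) → (EuclideanSpace ℝ (Fin 3)) :=
    fun y => ballCutoff c (2 * s) y • hi y with hfdef
  have hf1 : ContDiff ℝ 1 f := hχ1.smul hhi1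
  have hfc : HasCompactSupport f := hχc.smul_right
  have hfcont : Continuous f := hf1.continuous
  have hf_le : ∀ y, ‖f y‖ ≤ ‖curl V y‖ := fun y => by
    show ‖ballCutoff c (2 * s) y • hi y‖ ≤ ‖curl V y‖
    rw [norm_smul, Real.norm_eq_abs, abs_of_nonneg (hχ01 y).1]
    calc ballCutoff c (2 * s) y * ‖hi y‖ ≤ 1 * ‖curl V y‖ :=
          mul_le_mul (hχ01 y).2 (hhi_le y) (norm_nonneg _) zero_le_one
      _ = ‖curl V y‖ := one_mul _
  have hf0 : ∀ y, y ∉ closedBall c (6 * s) → f y = 0 := fun y hy => by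
    have : ballCutoff c (2 * s) y = 0 := by
      by_contra h
      exact hy (hsub3 (hχO (mem_support.2 h)))
    show ballCutoff c (2 * s) y • hi y = 0
    rw [this, zero_smul]
  obtain ⟨Cl, hCl⟩ := hf1.lipschitzWith_of_hasCompactSupport hfc one_ne_zero
  have hhol : HolderWith Cl 1 f := hCl.holderWith
  have hKf1 : ContDiff ℝ 1 (biotSavart f) := contDiff_biotSavart one_pos hhol hfc
  set U : (EuclideanSpace ℝ (Fin 3)) → (EuclideanSpace ℝ (Fin 3)) := fun x => V x - biotSavart f x with hU
  have hU1 : ContDiff ℝ 1 U := hV1.sub hKf1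
  have hDU : ∀ x, fderiv ℝ U x = fderiv ℝ V x - fderiv ℝ (biotSavart f) x := fun x =>
    fderiv_fun_sub ((hV1.differentiable one_ne_zero) x) ((hKf1.differentiable one_ne_zero) x)
  -- ### the sup bound for `U` on `B(c, 3s)` and the globally bounded `Ũ = θ U`
  set I : ℝ := ∫ y in closedBall c (6 * s), (‖curl V y‖ + ‖fderiv ℝ V y‖ + ‖V y‖) with hIdef
  have hI0 : 0 ≤ I := setIntegral_nonneg measurableSet_closedBall fun y _ => by positivity
  set S : ℝ := 30 * (2 * R) * s + CF * I with hSdef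
  have hS : ∀ x ∈ ball c (3 * s), ‖U x‖ ≤ S := by
    intro x hx
    have hΛ : ∀ y ∈ ball c (6 * s), ‖curl V y - hi y‖ ≤ 2 * R := fun y _ => by
      have e : curl V y - hi y = lo y := by rw [hlohi y]; abel
      rw [e]; exact hlo_le y
    exact hsupF hV hdiv hhicont hΛ hx
  have hS0 : 0 ≤ S := by positivity
  have hIle : I ≤ Real.sqrt m * (sL + sF + sE) := by
    have h1 := setIntegral_closedBall_le_sqrt_vol_mul_sqrt hωc.norm (fun x => norm_nonneg _) c (6 * s)
    have h2 := setIntegral_closedBall_le_sqrt_vol_mul_sqrt hDV.norm (fun x => norm_nonneg _) c (6 * s)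
    have h3 := setIntegral_closedBall_le_sqrt_vol_mul_sqrt hVc.norm (fun x => norm_nonneg _) c (6 * s)
    have Iω : IntegrableOn (fun y => ‖curl V y‖) (closedBall c (6 * s)) :=
      hωc.norm.continuousOn.integrableOn_compact (isCompact_closedBall _ _)
    have IDv : IntegrableOn (fun y => ‖fderiv ℝ V y‖) (closedBall c (6 * s)) :=
      hDV.norm.continuousOn.integrableOn_compact (isCompact_closedBall _ _)
    have Iv : IntegrableOn (fun y => ‖V y‖) (closedBall c (6 * s)) :=
      hVc.norm.continuousOn.integrableOn_compact (isCompact_closedBall _ _)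
    have I2 : IntegrableOn (fun y => ‖curl V y‖ + ‖fderiv ℝ V y‖) (closedBall c (6 * s)) := Iω.add IDv
    have hsplit : I = (∫ y in closedBall c (6 * s), ‖curl V y‖) +
        (∫ y in closedBall c (6 * s), ‖fderiv ℝ V y‖) + ∫ y in closedBall c (6 * s), ‖V y‖ := by
      rw [hIdef, integral_add I2 Iv, integral_add Iω IDv]
    rw [hsplit]
    have e : Real.sqrt m * (sL + sF + sE) = Real.sqrt m * sL + Real.sqrt m * sF + Real.sqrt m * sE := by ring
    rw [e]
    exact add_le_add (add_le_add h1 h2) h3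
  set S' : ℝ := σ + a * (sL + sF + sE) with hS'
  have hSS' : S ≤ S' := by
    have h1 : CF * I ≤ CF * (Real.sqrt m * (sL + sF + sE)) := mul_le_mul_of_nonneg_left hIle hCF0
    have e : 30 * (2 * R) * s = σ := by rw [hσ, hRdef]; ring
    have e2 : CF * (Real.sqrt m * (sL + sF + sE)) = a * (sL + sF + sE) := by rw [hadef]; ring
    rw [hSdef, hS', e]
    linarith
  have hS'0 : 0 ≤ S' := hS0.trans hSS'
  have hS'sq : S' ^ 2 ≤ 4 * (σ ^ 2 + a ^ 2 * (Yl + Fl + El)) := by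
    have h : S' ^ 2 ≤ 4 * (σ ^ 2 + (a * sL) ^ 2 + (a * sF) ^ 2 + (a * sE) ^ 2) := by
      rw [hS']
      nlinarith only [sq_nonneg (σ - a * sL), sq_nonneg (σ - a * sF), sq_nonneg (σ - a * sE),
        sq_nonneg (a * sL - a * sF), sq_nonneg (a * sL - a * sE), sq_nonneg (a * sF - a * sE)]
    calc S' ^ 2 ≤ 4 * (σ ^ 2 + (a * sL) ^ 2 + (a * sF) ^ 2 + (a * sE) ^ 2) := h
      _ = 4 * (σ ^ 2 + a ^ 2 * (Yl + Fl + El)) := by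
          simp only [mul_pow, hsL2, hsF2, hsE2]; ring
  have hθ1 : ContDiff ℝ 1 (ballCutoff c s) := contDiff_ballCutoff c s
  have hθ01 : ∀ y, 0 ≤ ballCutoff c s y ∧ ballCutoff c s y ≤ 1 := fun y =>
    ⟨ballCutoff_nonneg _ _ _, ballCutoff_le_one _ _ _⟩
  set Ut : (EuclideanSpace ℝ (Fin 3)) → (EuclideanSpace ℝ (Fin 3)) := fun x => ballCutoff c s x • U x with hUt
  have hUt1 : ContDiff ℝ 1 Ut := hθ1.smul hU1
  have hUtS : ∀ x, ‖Ut x‖ ≤ S := by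
    intro x
    show ‖ballCutoff c s x • U x‖ ≤ S
    rw [norm_smul, Real.norm_eq_abs, abs_of_nonneg (hθ01 x).1]
    by_cases hx : x ∈ ball c (3 * s)
    · calc ballCutoff c s x * ‖U x‖ ≤ 1 * S := mul_le_mul (hθ01 x).2 (hS x hx) (norm_nonneg _) zero_le_one
        _ = S := one_mul _
    · have : ballCutoff c s x = 0 := by
        rw [mem_ball, dist_eq_norm, not_lt] at hx
        exact ballCutoff_eq_zero hs hx
      rw [this, zero_mul]; exact hS0
  -- `DŨ = DU` near the support of `φ`
  have hDUt : ∀ x, φ x ≠ 0 → fderiv ℝ Ut x = fderiv ℝ U x := by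
    intro x hx
    have hxs : x ∈ ball c (2 * s) := by
      have := hφx x hx; rw [mem_closedBall] at this; rw [mem_ball]; linarith
    have hev : Ut =ᶠ[𝓝 x] U := by
      filter_upwards [ballCutoff_eventuallyEq_one hs hxs] with y hy
      show ballCutoff c s y • U y = U y
      rw [hy, one_smul]
    exact hev.fderiv_eq
  -- ### the pointwise decomposition of the stretching density
  set Et : (EuclideanSpace ℝ (Fin 3)) → ℝ := fun x =>
    φ x ^ 2 * (⟪lo x, fderiv ℝ V x (curl V x)⟫ + ⟪hi x, fderiv ℝ V x (lo x)⟫) with hEt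
  set Bt : (EuclideanSpace ℝ (Fin 3)) → ℝ := fun x => ⟪φ x • hi x, fderiv ℝ Ut x (φ x • hi x)⟫ with hBt
  set Gt : (EuclideanSpace ℝ (Fin 3)) → ℝ := fun x =>
    φ x ^ 2 * ⟪hi x, fderiv ℝ (biotSavart f) x (hi x)⟫ with hGt
  have hsplit : ∀ x, φ x ^ 2 * ⟪curl V x, fderiv ℝ V x (curl V x)⟫ = Et x + (Bt x + Gt x) := by
    intro x
    by_cases hφ0 : φ x = 0
    · have e1 : Et x = 0 := by rw [hEt]; simp only; rw [hφ0]; ring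
      have e2 : Bt x = 0 := by rw [hBt]; simp only; rw [hφ0, zero_smul, inner_zero_left]
      have e3 : Gt x = 0 := by rw [hGt]; simp only; rw [hφ0]; ring
      rw [e1, e2, e3, hφ0]; ring
    have h1 : Bt x + Gt x = φ x ^ 2 * ⟪hi x, fderiv ℝ V x (hi x)⟫ := by
      show ⟪φ x • hi x, fderiv ℝ Ut x (φ x • hi x)⟫ +
          φ x ^ 2 * ⟪hi x, fderiv ℝ (biotSavart f) x (hi x)⟫ = _
      rw [hDUt x hφ0, map_smul, real_inner_smul_left, real_inner_smul_right, hDU x,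
        sub_apply, inner_sub_right]
      ring
    rw [h1]
    show φ x ^ 2 * ⟪curl V x, fderiv ℝ V x (curl V x)⟫ =
      φ x ^ 2 * (⟪lo x, fderiv ℝ V x (curl V x)⟫ + ⟪hi x, fderiv ℝ V x (lo x)⟫) +
        φ x ^ 2 * ⟪hi x, fderiv ℝ V x (hi x)⟫
    have hω' := hlohi x
    have e : ⟪curl V x, fderiv ℝ V x (curl V x)⟫ =
        (⟪lo x, fderiv ℝ V x (curl V x)⟫ + ⟪hi x, fderiv ℝ V x (lo x)⟫) + ⟪hi x, fderiv ℝ V x (hi x)⟫ := by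
      rw [hω']
      simp only [map_add, inner_add_left, inner_add_right]
      ring
    rw [e]; ring
  -- integrability of the three pieces
  have hEt_pt : ∀ x, |Et x| ≤ φ x ^ 2 * (2 * R * (‖fderiv ℝ V x‖ ^ 2 + ‖curl V x‖ ^ 2)) := by
    intro x
    rw [hEt]
    simp only
    rw [abs_mul, abs_of_nonneg (sq_nonneg _)]
    exact mul_le_mul_of_nonneg_left
      (abs_inner_low_terms_le (fderiv ℝ V x) (by positivity) (hlo_le x) (hhi_le x)) (sq_nonneg _)
  have Idom : Integrable fun x => φ x ^ 2 * (2 * R * (‖fderiv ℝ V x‖ ^ 2 + ‖curl V x‖ ^ 2)) :=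
    integrable_sq_mul_of_hasCompactSupport hφcont hφc
      (continuous_const.mul ((hDV.norm.pow 2).add (hωc.norm.pow 2)))
  have IEt : Integrable Et := by
    have hcont : Continuous Et := (hφcont.pow 2).mul
      ((hlocont.inner (hDV.clm_apply hωc)).add (hhicont.inner (hDV.clm_apply hlocont)))
    refine Idom.mono' hcont.aestronglyMeasurable (Eventually.of_forall fun x => ?_)
    rw [Real.norm_eq_abs]
    exact hEt_pt x
  have hZ1 : ContDiff ℝ 1 (fun x => φ x • hi x) := hφ.smul hhi1
  have hZc : HasCompactSupport (fun x => φ x • hi x) := hφc.smul_right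
  have hZcont : Continuous (fun x => φ x • hi x) := hZ1.continuous
  have IBt : Integrable Bt := by
    refine (hZcont.inner ((hUt1.continuous_fderiv one_ne_zero).clm_apply hZcont)).integrable_of_hasCompactSupport ?_
    refine hZc.mono fun x hx => ?_
    rw [mem_support] at hx ⊢
    intro h
    apply hx
    show ⟪φ x • hi x, fderiv ℝ Ut x (φ x • hi x)⟫ = 0
    rw [h, inner_zero_left]
  have IGt : Integrable Gt :=
    integrable_sq_mul_of_hasCompactSupport hφcont hφc
      (hhicont.inner ((hKf1.continuous_fderiv one_ne_zero).clm_apply hhicont))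
  have IBG : Integrable fun x => Bt x + Gt x := IBt.add IGt
  have hP : ∫ x, φ x ^ 2 * ⟪curl V x, fderiv ℝ V x (curl V x)⟫ =
      (∫ x, Et x) + ((∫ x, Bt x) + ∫ x, Gt x) := by
    rw [← integral_add IBt IGt, ← integral_add IEt IBG]
    exact integral_congr_ae (Eventually.of_forall hsplit)
  -- ### bound of the low terms
  have hTE : 2 * ∫ x, Et x ≤ 8 * Ω * (Fl + Yl) := by
    have h1 : ∫ x, Et x ≤ ∫ x, φ x ^ 2 * (2 * R * (‖fderiv ℝ V x‖ ^ 2 + ‖curl V x‖ ^ 2)) :=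
      integral_mono IEt Idom fun x => (le_abs_self _).trans (hEt_pt x)
    have h2 : ∫ x, φ x ^ 2 * (2 * R * (‖fderiv ℝ V x‖ ^ 2 + ‖curl V x‖ ^ 2)) ≤
        ∫ x in closedBall c (6 * s), 2 * R * (‖fderiv ℝ V x‖ ^ 2 + ‖curl V x‖ ^ 2) :=
      integral_sq_mul_le_setIntegral hφcont hφ01 (hφs.trans hsub2)
        (continuous_const.mul ((hDV.norm.pow 2).add (hωc.norm.pow 2))) fun x => by positivity
    have h3 : ∫ x in closedBall c (6 * s), 2 * R * (‖fderiv ℝ V x‖ ^ 2 + ‖curl V x‖ ^ 2) =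
        2 * R * (Fl + Yl) := by
      rw [integral_const_mul, integral_add IFl IYl]
    have e : 2 * (2 * R * (Fl + Yl)) = 8 * Ω * (Fl + Yl) := by rw [hRdef]; ring
    linarith
  -- ### bound of the `U` term by integration by parts
  have hTB : ∫ x, Bt x ≤ 12 * cθ * S' * Real.sqrt Yφ * Real.sqrt D' + 6 * Bφ * (S' ^ 2 * Yφ + Yl) := by
    have h := integral_inner_smul_fderiv_smul_le hφ hφ01 hφs hs6 hBφ0 hBφ hω1 hhi1 hhi_le hcθ0
      hDhi_le hUt1 hS0 hUtS
    have h' : ∫ x, Bt x ≤ 12 * cθ * S * Real.sqrt Yφ * Real.sqrt D' + 6 * Bφ * (S ^ 2 * Yφ + Yl) := h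
    have e1 : 12 * cθ * S * Real.sqrt Yφ * Real.sqrt D' ≤ 12 * cθ * S' * Real.sqrt Yφ * Real.sqrt D' := by
      have : 0 ≤ 12 * cθ := by positivity
      have : 0 ≤ 12 * cθ * Real.sqrt Yφ * Real.sqrt D' := by positivity
      nlinarith only [hSS', this]
    have e2 : S ^ 2 * Yφ ≤ S' ^ 2 * Yφ := mul_le_mul_of_nonneg_right (pow_le_pow_left₀ hS0 hSS' 2) hYφ0
    have e3 := mul_le_mul_of_nonneg_left (add_le_add_right e2 Yl) (by positivity : (0:ℝ) ≤ 6 * Bφ)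
    linarith only [h', e1, e3]
  -- ### bound of the high term: depletion, two-radii Riesz bound, Cauchy–Schwarz, Sobolev
  have hdir' : ∀ x ∈ ball c (6 * s), ∀ y ∈ ball c (6 * s), Ω < ‖curl V x‖ → Ω < ‖curl V y‖ →
      Real.sqrt (1 - ⟪vorticityDirection (curl V) x, vorticityDirection (curl V) y⟫ ^ 2) ≤
        M * Real.sqrt ‖x - y‖ := fun x hx y hy hωx hωy =>
    (hdir x hx y hy hωx hωy).trans (mul_le_mul_of_nonneg_right hMhM (Real.sqrt_nonneg _))
  have hGpt : ∀ x, |Gt x| ≤ φ x ^ 2 * (A * M * ‖curl V x‖ ^ 2 * ∫ y, ‖x - y‖ ^ (-(5 / 2 : ℝ)) * ‖f y‖) := by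
    intro x
    rw [hGt]
    simp only
    rw [abs_mul, abs_of_nonneg (sq_nonneg _)]
    by_cases hφ0 : φ x = 0
    · rw [hφ0]; simp
    · have hxO : x ∈ ball c (6 * s) := hsub1 (hφx x hφ0)
      exact mul_le_mul_of_nonneg_left
        (hdep hω1 hR hΩR hM0 hχ1 hχc (fun y => (hχ01 y).1) hχO hdir' hxO) (sq_nonneg _)
  have hTG := integral_highTerm_le hφ hφ01 hφs hs6 hBφ hω1 hfcont hfc hf_le hf0 IGt
    (mul_nonneg hA0 hM0) hGpt
  -- the `q` and `t` of the count
  set X2 : ℝ := 2 * D' + 2 * Bφ ^ 2 * Yl with hX2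
  have hX20 : 0 ≤ X2 := by positivity
  set sX : ℝ := Real.sqrt X2 with hsX
  have hsX0 : 0 ≤ sX := Real.sqrt_nonneg _
  have hKsX : 0 ≤ K * sX := mul_nonneg hK0.le hsX0
  set t : ℝ := Real.sqrt (K * sX) with htdef
  have ht0 : 0 ≤ t := Real.sqrt_nonneg _
  have ht2 : t ^ 2 = K * sX := Real.sq_sqrt hKsX
  have ht4 : t ^ 4 = K ^ 2 * (2 * D' + 2 * Bφ ^ 2 * Yl) := by
    rw [show (4 : ℕ) = 2 * 2 by norm_num, pow_mul, ht2, mul_pow, hsX, Real.sq_sqrt hX20]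
  set q : ℝ := Real.sqrt (sL * sY) with hqdef
  have hq0 : 0 ≤ q := Real.sqrt_nonneg _
  have hq2 : q ^ 2 = sL * sY := Real.sq_sqrt (mul_nonneg hsL0 hsY0)
  have hq4 : q ^ 4 = Yl * Yφ := by
    rw [show (4 : ℕ) = 2 * 2 by norm_num, pow_mul, hq2, mul_pow, hsL2, hsY, Real.sq_sqrt hYφ0]
  have hTG' : ∫ x, Gt x ≤ A * M * (cn * q * t ^ 3 + cf * ((1 + Real.sqrt Yl) * Real.sqrt Yl * Yφ)) := hTG
  -- ### the final count
  have hcount := localized_stretching_count (TE := ∫ x, Et x) (TB := ∫ x, Bt x) (TG := ∫ x, Gt x)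
    (σ := σ) (a := a) (El := El) hν hK0 hA0 hM0 hcn0 hcf0 hBφ0 hYφ0 hD'0 hYl0 hFl0 hq0 hq4 ht0 ht4
    hS'sq hTE hTB hTG'
  have hνD : ν * D' ≤ ν * Dφ := mul_le_mul_of_nonneg_left hD'D hν.le
  rw [hP]
  linarith only [hcount, hνD]


/-! ### The geometric depletion for the cut-off high part, general Hölder exponent -/

/-- The potential `∫ |x−y|^{α−3} |h(y)| dy` (`α > 0`) of a continuous compactly supported `h`
converges absolutely. [folklore] -/
private theorem integrable_rieszKernel_mul_norm_exp {α : ℝ} (hα : 0 < α)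
    {h : (EuclideanSpace ℝ (Fin 3)) → (EuclideanSpace ℝ (Fin 3))} (hh : Continuous h)
    (hhc : HasCompactSupport h) (x : (EuclideanSpace ℝ (Fin 3))) :
    Integrable fun y => ‖x - y‖ ^ (α - 3) * ‖h y‖ := by
  obtain ⟨M₀, hM₀⟩ := hh.bounded_above_of_compact_support hhc
  have hM₀0 : 0 ≤ M₀ := (norm_nonneg _).trans (hM₀ x)
  obtain ⟨R₀, hR₀⟩ := hhc.isCompact.isBounded.subset_closedBall (0 : (EuclideanSpace ℝ (Fin 3)))
  set ρ' : ℝ := |R₀| + ‖x‖ + 1 with hρ'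
  have hexp : α - 3 = -(3 - α) := by ring
  have hball : Integrable fun z : (EuclideanSpace ℝ (Fin 3)) =>
      (ball (0 : (EuclideanSpace ℝ (Fin 3))) ρ').indicator (fun z => ‖z‖ ^ (α - 3)) z := by
    rw [integrable_indicator_iff measurableSet_ball, hexp]
    exact NewtonPotentialHolder.integrableOn_ball_norm_rpow_neg (by linarith) ρ'
  have hmaj : Integrable fun y => M₀ *
      (ball (0 : (EuclideanSpace ℝ (Fin 3))) ρ').indicator (fun z => ‖z‖ ^ (α - 3)) (x - y) :=
    (hball.comp_sub_left x).const_mul _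
  have hmeas : AEStronglyMeasurable (fun y => ‖x - y‖ ^ (α - 3) * ‖h y‖) volume :=
    (((measurable_const.sub measurable_id).norm.pow_const _).mul
      hh.measurable.norm).aestronglyMeasurable
  refine hmaj.mono' hmeas (Eventually.of_forall fun y => ?_)
  have hk0 : 0 ≤ ‖x - y‖ ^ (α - 3) := Real.rpow_nonneg (norm_nonneg _) _
  rw [Real.norm_of_nonneg (mul_nonneg hk0 (norm_nonneg _))]
  by_cases hy : h y = 0
  · rw [hy, norm_zero, mul_zero]
    exact mul_nonneg hM₀0 (indicator_nonneg (fun z _ => Real.rpow_nonneg (norm_nonneg _) _) _)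
  · have hyR : ‖y‖ ≤ R₀ := mem_closedBall_zero_iff.1 (hR₀ (subset_tsupport _ (mem_support.2 hy)))
    have hxy : ‖x - y‖ < ρ' := by
      calc ‖x - y‖ ≤ ‖x‖ + ‖y‖ := norm_sub_le _ _
        _ < |R₀| + ‖x‖ + 1 := by linarith [le_abs_self R₀]
    have hmem : x - y ∈ ball (0 : (EuclideanSpace ℝ (Fin 3))) ρ' := mem_ball_zero_iff.2 hxy
    rw [indicator_of_mem hmem]
    calc ‖x - y‖ ^ (α - 3) * ‖h y‖ ≤ ‖x - y‖ ^ (α - 3) * M₀ :=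
          mul_le_mul_of_nonneg_left (hM₀ y) hk0
      _ = M₀ * ‖x - y‖ ^ (α - 3) := mul_comm _ _

/-- **Depleted self-stretching of the high vorticity cut off to a ball, general Hölder exponent**
(Grujić–Zhang 2006, §3, p. 562: after the near/far split (3.5) of Constantin's representation
of the stretching factor, the coherence hypothesis `|sin φ(ξ(x+y,t), ξ(x,t))| ≤ c|y|^{1/q}` gives
"`|α₁(x,t)| ≤ c ∫_{|y|≤r} |ω(x+y,t)| |y|^{−(3−1/q)} dy`" (display after (3.6)); Beirão da
Veiga–Berselli 2002,
(4.6) for the whole space with exponent `α`; the case `α = ½` is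
`exists_abs_inner_highPart_fderiv_biotSavart_cutoff_le_holder`). There is an absolute `A ≥ 0`
such that: for a `C¹` field `w`, its high part `w_hi = (1 − θ_R(w)) w` (`R > 0`), a threshold
`Ω ≤ R`, `M ≥ 0`, an exponent `α > 0`, a `C¹` compactly supported weight `χ ≥ 0` supported
inside a set `O` on which `√(1 − ⟪ξ(x), ξ(y)⟫²) ≤ M |x−y|^α` holds for all pairs with
`|w(x)|, |w(y)| > Ω`, one has at every `x ∈ O`, with `f = χ w_hi`,
`|⟪w_hi(x), ∇(K ∗ f)(x) w_hi(x)⟫| ≤ A M |w(x)|² ∫ |x−y|^{α−3} |f(y)| dy` — the first brick of a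
localized twin of the hybrid criteria `holder_direction_vorticityLqLp_criterion`
(`grujicZhang2006_localized_hybrid_coherence`). [cite: GrujicZhang2006, §3 (3.5) and the display after (3.6) (p. 562); BeiraodaveigaBerselli2002, Lemma 4.1 proof (4.6) (p. 352)] -/
theorem exists_abs_inner_highPart_fderiv_biotSavart_cutoff_le_holderExp :
    ∃ A : ℝ, 0 ≤ A ∧ ∀ ⦃w : (EuclideanSpace ℝ (Fin 3)) → (EuclideanSpace ℝ (Fin 3))⦄
      (_ : ContDiff ℝ 1 w) ⦃R Ω M α : ℝ⦄ (_ : 0 < R) (_ : Ω ≤ R) (_ : 0 ≤ M) (_ : 0 < α)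
      ⦃χ : (EuclideanSpace ℝ (Fin 3)) → ℝ⦄ (_ : ContDiff ℝ 1 χ) (_ : HasCompactSupport χ) (_ : ∀ y, 0 ≤ χ y)
      ⦃O : Set (EuclideanSpace ℝ (Fin 3))⦄ (_ : support χ ⊆ O)
      (_ : ∀ x ∈ O, ∀ y ∈ O, Ω < ‖w x‖ → Ω < ‖w y‖ →
        Real.sqrt (1 - ⟪vorticityDirection w x, vorticityDirection w y⟫ ^ 2) ≤
          M * ‖x - y‖ ^ α) ⦃x : (EuclideanSpace ℝ (Fin 3))⦄ (_ : x ∈ O),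
      |⟪(1 - radialCutoff R (2 * R) (w x)) • w x,
        fderiv ℝ (biotSavart fun y => χ y • ((1 - radialCutoff R (2 * R) (w y)) • w y)) x
          ((1 - radialCutoff R (2 * R) (w x)) • w x)⟫| ≤
        A * M * ‖w x‖ ^ 2 *
          ∫ y, ‖x - y‖ ^ (α - 3) * ‖χ y • ((1 - radialCutoff R (2 * R) (w y)) • w y)‖ := by
  obtain ⟨A, hA0, hdep⟩ := exists_abs_inner_fderiv_biotSavart_le
  refine ⟨A, hA0, ?_⟩
  intro w hw R Ω M α hR hΩR hM hα χ hχ hχc hχ0 O hχO hdir x hxO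
  set hi : (EuclideanSpace ℝ (Fin 3)) → (EuclideanSpace ℝ (Fin 3)) :=
    fun y => (1 - radialCutoff R (2 * R) (w y)) • w y with hhi
  set f : (EuclideanSpace ℝ (Fin 3)) → (EuclideanSpace ℝ (Fin 3)) := fun y => χ y • hi y with hf
  have hhi1 : ContDiff ℝ 1 hi := contDiff_highPart hw R
  have hf1 : ContDiff ℝ 1 f := hχ.smul hhi1
  have hfc : HasCompactSupport f := hχc.smul_right
  have hfcont : Continuous f := hf1.continuous
  set P : ℝ := ∫ y, ‖x - y‖ ^ (α - 3) * ‖f y‖ with hP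
  have hP0 : 0 ≤ P := integral_nonneg fun y =>
    mul_nonneg (Real.rpow_nonneg (norm_nonneg _) _) (norm_nonneg _)
  show |⟪hi x, fderiv ℝ (biotSavart f) x (hi x)⟫| ≤ A * M * ‖w x‖ ^ 2 * P
  by_cases hx : hi x = 0
  · rw [hx, inner_zero_left, abs_zero]
    positivity
  -- the direction at `x`
  have hwR : R < ‖w x‖ := lt_norm_of_highPart_ne_zero hR hx
  have hw0 : w x ≠ 0 := by
    intro h; rw [h, norm_zero] at hwR; exact lt_irrefl _ (hR.trans hwR)
  have hxΩ : Ω < ‖w x‖ := hΩR.trans_lt hwR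
  set e : (EuclideanSpace ℝ (Fin 3)) := vorticityDirection w x with he
  have he1 : ‖e‖ = 1 := norm_vorticityDirection w hw0
  set c : ℝ := (1 - radialCutoff R (2 * R) (w x)) * ‖w x‖ with hc
  have hhix : hi x = c • e := highPart_eq_smul_vorticityDirection w R x
  have hc0 : 0 ≤ c := mul_nonneg (sub_nonneg.2 (radialCutoff_le_one _ _ _)) (norm_nonneg _)
  have hcle : c ≤ ‖w x‖ :=
    mul_le_of_le_one_left (norm_nonneg _) (sub_le_self _ (radialCutoff_nonneg _ _ _))
  have hfx : f x = (χ x * c) • e := by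
    show χ x • hi x = (χ x * c) • e
    rw [hhix, smul_smul]
  -- Hölder continuity of `f`
  obtain ⟨Cl, hCl⟩ := hf1.lipschitzWith_of_hasCompactSupport hfc one_ne_zero
  have hhol : HolderWith Cl 1 f := hCl.holderWith
  -- the depleted majorant
  set g : (EuclideanSpace ℝ (Fin 3)) → ℝ := fun y => A * M * (‖x - y‖ ^ (α - 3) * ‖f y‖)
    with hg
  have hgi : Integrable g :=
    (integrable_rieszKernel_mul_norm_exp hα hfcont hfc x).const_mul (A * M)
  have hg0 : ∀ y, 0 ≤ g y := fun y => by
    rw [hg]; exact mul_nonneg (mul_nonneg hA0 hM)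
      (mul_nonneg (Real.rpow_nonneg (norm_nonneg _) _) (norm_nonneg _))
  have hdom : ∀ y, y ≠ x → A * ‖f y - ⟪f y, e⟫ • e‖ * (‖x - y‖ ^ 3)⁻¹ ≤ g y := by
    intro y hyx
    have hr : 0 < ‖x - y‖ := norm_pos_iff.2 (sub_ne_zero.2 (Ne.symm hyx))
    have hfac : f y - ⟪f y, e⟫ • e = χ y • (hi y - ⟪hi y, e⟫ • e) := by
      show χ y • hi y - ⟪χ y • hi y, e⟫ • e = χ y • (hi y - ⟪hi y, e⟫ • e)
      rw [real_inner_smul_left, smul_sub, mul_smul]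
    by_cases hχy : χ y = 0
    · rw [hfac, hχy, zero_smul, norm_zero, mul_zero, zero_mul]
      exact hg0 y
    · have hyO : y ∈ O := hχO (mem_support.2 hχy)
      have hle : ‖hi y - ⟪hi y, e⟫ • e‖ ≤ ‖hi y‖ * min 1 (M * ‖x - y‖ ^ α) := by
        refine norm_highPart_sub_inner_smul_le hR he1 fun hyR => ?_
        exact hdir x hxO y hyO hxΩ (hΩR.trans_lt hyR)
      have hle' : ‖hi y - ⟪hi y, e⟫ • e‖ ≤ ‖hi y‖ * (M * ‖x - y‖ ^ α) :=
        hle.trans (mul_le_mul_of_nonneg_left (min_le_right _ _) (norm_nonneg _))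
      have hnf : ‖f y - ⟪f y, e⟫ • e‖ ≤ ‖f y‖ * (M * ‖x - y‖ ^ α) := by
        rw [hfac, norm_smul, Real.norm_eq_abs, abs_of_nonneg (hχ0 y)]
        have hfy : ‖f y‖ = χ y * ‖hi y‖ := by
          show ‖χ y • hi y‖ = χ y * ‖hi y‖
          rw [norm_smul, Real.norm_eq_abs, abs_of_nonneg (hχ0 y)]
        rw [hfy, mul_assoc]
        exact mul_le_mul_of_nonneg_left hle' (hχ0 y)
      have hker : ‖x - y‖ ^ α * (‖x - y‖ ^ 3)⁻¹ = ‖x - y‖ ^ (α - 3) := by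
        rw [← Real.rpow_natCast, ← Real.rpow_neg hr.le, ← Real.rpow_add hr]
        norm_num
        ring_nf
      rw [hg]
      calc A * ‖f y - ⟪f y, e⟫ • e‖ * (‖x - y‖ ^ 3)⁻¹
          ≤ A * (‖f y‖ * (M * ‖x - y‖ ^ α)) * (‖x - y‖ ^ 3)⁻¹ := by gcongr
        _ = A * M * ((‖x - y‖ ^ α * (‖x - y‖ ^ 3)⁻¹) * ‖f y‖) := by ring
        _ = A * M * (‖x - y‖ ^ (α - 3) * ‖f y‖) := by rw [hker]
  have hkey := hdep one_pos hhol hfc he1 ⟨χ x * c, hfx⟩ hgi hdom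
  -- assemble
  have hinner : ⟪hi x, fderiv ℝ (biotSavart f) x (hi x)⟫ =
      c ^ 2 * ⟪e, fderiv ℝ (biotSavart f) x e⟫ := by
    rw [hhix, map_smul, real_inner_smul_left, real_inner_smul_right]
    ring
  rw [hinner, abs_mul, abs_of_nonneg (sq_nonneg c)]
  have hint_le : ∫ y, g y = A * M * P := by
    rw [hg, integral_const_mul]
  calc c ^ 2 * |⟪e, fderiv ℝ (biotSavart f) x e⟫| ≤ ‖w x‖ ^ 2 * (A * M * P) :=
        mul_le_mul (pow_le_pow_left₀ hc0 hcle 2) (hkey.trans hint_le.le) (abs_nonneg _)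
          (sq_nonneg _)
    _ = A * M * ‖w x‖ ^ 2 * P := by ring

/-! ### The cut-off geometric depletion with a coherence WEIGHT carried by the convolution
variable (Grujić–Guberović 2010, Thm. 2, the bound (14) p. 415) -/

set_option maxHeartbeats 800000 in
/-- **The cut-off high-vorticity stretching factor is depleted by a coherence weight on the
convolution variable.** Same setting as
`exists_abs_inner_highPart_fderiv_biotSavart_cutoff_le_holderExp`, but the uniform Hölder constant
`M` is replaced by a nonnegative, bounded, measurable weight `m(y)` evaluated at the INNER
(convolution) point: if `√(1 − ⟪ξ(x), ξ(y)⟫²) ≤ m(y)|x − y|^α` for all `x, y ∈ O` with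
`|w(x)|, |w(y)| > Ω` (`ξ = w/|w|`), then for `x ∈ O`
`|⟪w_hi(x), ∇(K ∗ (χ w_hi))(x) w_hi(x)⟫| ≤ A |w(x)|² ∫ |x − y|^{α−3} m(y) |χ(y) w_hi(y)| dy`.
This is Grujić–Guberović's bound (14) (p. 415), "`J ≤ c ∫∫ ρ_{γ,2r}|ω(x)| (∫ |ψω(y)|/|x−y|^{3−γ} dy)
|ψω(x)| dx dt`", with the `γ`-Hölder measure of coherence `ρ_{γ,2r}` attached to the convolution
variable `y` instead of `x` (the quotient `|sin φ(ξ(x), ξ(y))|/|x − y|^γ` is symmetric in `x, y`,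
so either end-point's supremum dominates it); this is the form in which the weight enters a
Hardy–Littlewood–Sobolev density. [cite: GrujicGuberovic2010, Thm. 2 proof, (13)–(14) (p. 415); ConstantinFeffermanIndiana1993, §2 (2.13)–(2.14)] -/
theorem exists_abs_inner_highPart_fderiv_biotSavart_cutoff_le_holderWeight :
    ∃ A : ℝ, 0 ≤ A ∧ ∀ ⦃w : (EuclideanSpace ℝ (Fin 3)) → (EuclideanSpace ℝ (Fin 3))⦄
      (_ : ContDiff ℝ 1 w) ⦃R Ω α Mb : ℝ⦄ (_ : 0 < R) (_ : Ω ≤ R) (_ : 0 < α)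
      ⦃m : (EuclideanSpace ℝ (Fin 3)) → ℝ⦄ (_ : Measurable m) (_ : ∀ y, 0 ≤ m y) (_ : ∀ y, m y ≤ Mb)
      ⦃χ : (EuclideanSpace ℝ (Fin 3)) → ℝ⦄ (_ : ContDiff ℝ 1 χ) (_ : HasCompactSupport χ) (_ : ∀ y, 0 ≤ χ y)
      ⦃O : Set (EuclideanSpace ℝ (Fin 3))⦄ (_ : support χ ⊆ O)
      (_ : ∀ x ∈ O, ∀ y ∈ O, Ω < ‖w x‖ → Ω < ‖w y‖ →
        Real.sqrt (1 - ⟪vorticityDirection w x, vorticityDirection w y⟫ ^ 2) ≤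
          m y * ‖x - y‖ ^ α) ⦃x : (EuclideanSpace ℝ (Fin 3))⦄ (_ : x ∈ O),
      |⟪(1 - radialCutoff R (2 * R) (w x)) • w x,
        fderiv ℝ (biotSavart fun y => χ y • ((1 - radialCutoff R (2 * R) (w y)) • w y)) x
          ((1 - radialCutoff R (2 * R) (w x)) • w x)⟫| ≤
        A * ‖w x‖ ^ 2 *
          ∫ y, ‖x - y‖ ^ (α - 3) * (m y * ‖χ y • ((1 - radialCutoff R (2 * R) (w y)) • w y)‖) := by
  obtain ⟨A, hA0, hdep⟩ := exists_abs_inner_fderiv_biotSavart_le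
  refine ⟨A, hA0, ?_⟩
  intro w hw R Ω α Mb hR hΩR hα m hmm hm0 hmM χ hχ hχc hχ0 O hχO hdir x hxO
  set hi : (EuclideanSpace ℝ (Fin 3)) → (EuclideanSpace ℝ (Fin 3)) :=
    fun y => (1 - radialCutoff R (2 * R) (w y)) • w y with hhi
  set f : (EuclideanSpace ℝ (Fin 3)) → (EuclideanSpace ℝ (Fin 3)) := fun y => χ y • hi y with hf
  have hhi1 : ContDiff ℝ 1 hi := contDiff_highPart hw R
  have hf1 : ContDiff ℝ 1 f := hχ.smul hhi1
  have hfc : HasCompactSupport f := hχc.smul_right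
  have hfcont : Continuous f := hf1.continuous
  have hMb0 : 0 ≤ Mb := (hm0 x).trans (hmM x)
  set P : ℝ := ∫ y, ‖x - y‖ ^ (α - 3) * (m y * ‖f y‖) with hP
  have hP0 : 0 ≤ P := integral_nonneg fun y =>
    mul_nonneg (Real.rpow_nonneg (norm_nonneg _) _) (mul_nonneg (hm0 y) (norm_nonneg _))
  show |⟪hi x, fderiv ℝ (biotSavart f) x (hi x)⟫| ≤ A * ‖w x‖ ^ 2 * P
  by_cases hx : hi x = 0
  · rw [hx, inner_zero_left, abs_zero]
    positivity
  -- the direction at `x`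
  have hwR : R < ‖w x‖ := lt_norm_of_highPart_ne_zero hR hx
  have hw0 : w x ≠ 0 := by
    intro h; rw [h, norm_zero] at hwR; exact lt_irrefl _ (hR.trans hwR)
  have hxΩ : Ω < ‖w x‖ := hΩR.trans_lt hwR
  set e : (EuclideanSpace ℝ (Fin 3)) := vorticityDirection w x with he
  have he1 : ‖e‖ = 1 := norm_vorticityDirection w hw0
  set c : ℝ := (1 - radialCutoff R (2 * R) (w x)) * ‖w x‖ with hc
  have hhix : hi x = c • e := highPart_eq_smul_vorticityDirection w R x
  have hc0 : 0 ≤ c := mul_nonneg (sub_nonneg.2 (radialCutoff_le_one _ _ _)) (norm_nonneg _)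
  have hcle : c ≤ ‖w x‖ :=
    mul_le_of_le_one_left (norm_nonneg _) (sub_le_self _ (radialCutoff_nonneg _ _ _))
  have hfx : f x = (χ x * c) • e := by
    show χ x • hi x = (χ x * c) • e
    rw [hhix, smul_smul]
  -- Hölder continuity of `f`
  obtain ⟨Cl, hCl⟩ := hf1.lipschitzWith_of_hasCompactSupport hfc one_ne_zero
  have hhol : HolderWith Cl 1 f := hCl.holderWith
  -- the depleted majorant (the weight `m` is bounded and measurable, the kernel part integrable)
  set g : (EuclideanSpace ℝ (Fin 3)) → ℝ := fun y => A * (m y * (‖x - y‖ ^ (α - 3) * ‖f y‖))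
    with hg
  have hgi : Integrable g := by
    have hk : Integrable fun y => ‖x - y‖ ^ (α - 3) * ‖f y‖ :=
      integrable_rieszKernel_mul_norm_exp hα hfcont hfc x
    have hmk : Integrable fun y => m y * (‖x - y‖ ^ (α - 3) * ‖f y‖) :=
      hk.bdd_mul hmm.aestronglyMeasurable (Eventually.of_forall fun y => by
        rw [Real.norm_of_nonneg (hm0 y)]; exact hmM y)
    exact hmk.const_mul A
  have hg0 : ∀ y, 0 ≤ g y := fun y => by
    rw [hg]; exact mul_nonneg hA0 (mul_nonneg (hm0 y)
      (mul_nonneg (Real.rpow_nonneg (norm_nonneg _) _) (norm_nonneg _)))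
  have hdom : ∀ y, y ≠ x → A * ‖f y - ⟪f y, e⟫ • e‖ * (‖x - y‖ ^ 3)⁻¹ ≤ g y := by
    intro y hyx
    have hr : 0 < ‖x - y‖ := norm_pos_iff.2 (sub_ne_zero.2 (Ne.symm hyx))
    have hfac : f y - ⟪f y, e⟫ • e = χ y • (hi y - ⟪hi y, e⟫ • e) := by
      show χ y • hi y - ⟪χ y • hi y, e⟫ • e = χ y • (hi y - ⟪hi y, e⟫ • e)
      rw [real_inner_smul_left, smul_sub, mul_smul]
    by_cases hχy : χ y = 0
    · rw [hfac, hχy, zero_smul, norm_zero, mul_zero, zero_mul]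
      exact hg0 y
    · have hyO : y ∈ O := hχO (mem_support.2 hχy)
      have hle : ‖hi y - ⟪hi y, e⟫ • e‖ ≤ ‖hi y‖ * min 1 (m y * ‖x - y‖ ^ α) := by
        refine norm_highPart_sub_inner_smul_le hR he1 fun hyR => ?_
        exact hdir x hxO y hyO hxΩ (hΩR.trans_lt hyR)
      have hle' : ‖hi y - ⟪hi y, e⟫ • e‖ ≤ ‖hi y‖ * (m y * ‖x - y‖ ^ α) :=
        hle.trans (mul_le_mul_of_nonneg_left (min_le_right _ _) (norm_nonneg _))
      have hnf : ‖f y - ⟪f y, e⟫ • e‖ ≤ ‖f y‖ * (m y * ‖x - y‖ ^ α) := by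
        rw [hfac, norm_smul, Real.norm_eq_abs, abs_of_nonneg (hχ0 y)]
        have hfy : ‖f y‖ = χ y * ‖hi y‖ := by
          show ‖χ y • hi y‖ = χ y * ‖hi y‖
          rw [norm_smul, Real.norm_eq_abs, abs_of_nonneg (hχ0 y)]
        rw [hfy, mul_assoc]
        exact mul_le_mul_of_nonneg_left hle' (hχ0 y)
      have hker : ‖x - y‖ ^ α * (‖x - y‖ ^ 3)⁻¹ = ‖x - y‖ ^ (α - 3) := by
        rw [← Real.rpow_natCast, ← Real.rpow_neg hr.le, ← Real.rpow_add hr]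
        norm_num
        ring_nf
      rw [hg]
      calc A * ‖f y - ⟪f y, e⟫ • e‖ * (‖x - y‖ ^ 3)⁻¹
          ≤ A * (‖f y‖ * (m y * ‖x - y‖ ^ α)) * (‖x - y‖ ^ 3)⁻¹ := by gcongr
        _ = A * (m y * ((‖x - y‖ ^ α * (‖x - y‖ ^ 3)⁻¹) * ‖f y‖)) := by ring
        _ = A * (m y * (‖x - y‖ ^ (α - 3) * ‖f y‖)) := by rw [hker]
  have hkey := hdep one_pos hhol hfc he1 ⟨χ x * c, hfx⟩ hgi hdom
  -- assemble
  have hinner : ⟪hi x, fderiv ℝ (biotSavart f) x (hi x)⟫ =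
      c ^ 2 * ⟪e, fderiv ℝ (biotSavart f) x e⟫ := by
    rw [hhix, map_smul, real_inner_smul_left, real_inner_smul_right]
    ring
  rw [hinner, abs_mul, abs_of_nonneg (sq_nonneg c)]
  have hint_le : ∫ y, g y = A * P := by
    rw [hg, integral_const_mul, hP]
    congr 1
    exact integral_congr_ae (Eventually.of_forall fun y => by ring)
  calc c ^ 2 * |⟪e, fderiv ℝ (biotSavart f) x e⟫| ≤ ‖w x‖ ^ 2 * (A * P) :=
        mul_le_mul (pow_le_pow_left₀ hc0 hcle 2) (hkey.trans hint_le.le) (abs_nonneg _)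
          (sq_nonneg _)
    _ = A * ‖w x‖ ^ 2 * P := by ring

end Literature.Analysis.FluidPDE

end
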